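import Summits.BirchSwinnertonDyer.BirchSwinnertonDyer.Theorems.TwoAdicConverseOrdLambdaHalfAtTwoBDPTwoVariableDefs
import Summits.BirchSwinnertonDyer.BirchSwinnertonDyer.Theorems.TwoAdicConverseBDPSelmerLowerDivisibilityAtTwoGaussContent
import Summits.BirchSwinnertonDyer.BirchSwinnertonDyer.Theorems.TwoAdicConverseBDPSelmerLowerDivisibilityAtTwoCharIdealPrincipal
import Summits.BirchSwinnertonDyer.BirchSwinnertonDyer.Theorems.TwoAdicConverseBDPSelmerLowerDivisibilityAtTwoFrameOfKatzSheet
import Summits.BirchSwinnertonDyer.BirchSwinnertonDyer.Theorems.TwoAdicConverseBDPSelmerLowerDivisibilityAtTwoPrimePinning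
import Summits.BirchSwinnertonDyer.BirchSwinnertonDyer.Theorems.TwoAdicConverseBDPSelmerLowerDivisibilityAtTwoTowerLineControl
import Summits.BirchSwinnertonDyer.BirchSwinnertonDyer.Theorems.TwoAdicConverseBDPSelmerLowerDivisibilityAtTwoSplitPrimePairExists
import Summits.BirchSwinnertonDyer.BirchSwinnertonDyer.Theorems.TwoAdicConverseBDPSelmerLowerDivisibilityAtTwoPairTransport
import Summits.BirchSwinnertonDyer.BirchSwinnertonDyer.Theorems.TwoAdicConverseBDPSplitLineFiniteOfTwoPrintFacts
import Summits.BirchSwinnertonDyer.BirchSwinnertonDyer.Theorems.TwoAdicConverseBDPSplitLineFiniteOfMuZero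
import Summits.BirchSwinnertonDyer.BirchSwinnertonDyer.Theorems.TwoAdicConverseBDPSelmerLowerDivisibilityAtTwoEisensteinDevissage
import Summits.BirchSwinnertonDyer.BirchSwinnertonDyer.Theorems.TwoAdicConverseBDPSelmerLowerDivisibilityAtTwoAcPinNecessary
import Summits.BirchSwinnertonDyer.BirchSwinnertonDyer.Theorems.TwoAdicConverseBDPAcLineCoinvariantDatumGoodOrd
import Summits.BirchSwinnertonDyer.BirchSwinnertonDyer.Theses.PrintCf2RubinValueTwo
import Literature.NumberTheory.FaltingsSerre.ParamodularCertificate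
import Literature.NumberTheory.EllipticCurves.KellerYin2024.CharacterSelmerGroups
import HarnessLib

/-!
# Line `two_variable_gv_squeeze_two` — skeleton for O2 `BDPSelmerLowerDivisibilityAtTwo` (stmt-BirchSwinnertonDyer-24728)

Crux idea `two-variable-gv-squeeze-two` (Cruxes/BDPSelmerLowerDivisibilityAtTwo/Ideas/two-variable-gv-squeeze-two.md;
crux-ideate seat 2, round 1, 2026-08-30).  Typed NODE (v1–v3): O2 ⟸ P0 ∧ S ∧ U ∧ R0T ∧ Rres.

**v9.2 = v9.1 + §8 «THE PRICE OF ACPIN AT (β)» (LEAD cruxlead-19556 g16, 2026-08-30; pen GEN 37 WAKE @c381ba39b702c918 (k2), director-bsd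
(642)(1)/(669); events = (e14) audit-2 ADDENDUM-6 @f240944fdca38ba2 «μ(G|_ac) = 0 ×6, λ-LIKE ×6, m/a/k algebraic and unread» and (e15)
tower-1 GEN 52–55 «the door X_Gr₂ → 𝔛_ac along the ac line, by name»): ONE import added
(`…Theorems.TwoAdicConverseBDPAcLineCoinvariantDatumGoodOrd`, p793449) and the sorry-free §8 at the end — ★ `acFibrePinning_needs_budget_at_beta`:
the registered stub ACPIN, specialised to a (β) rank-one frame datum's `J`, `C₀`, is EXACTLY the `hpin` binder of tower-1's
`TwoAdicBDPAcLineSpec.one_add_le_of_fibrePinned_of_rankOne_of_print_of_goodOrd`, so with the W⁺ reading `G(0,0) ∈ 𝔪` it costs the budget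
inequality `1 + a ≤ k + m` at that datum, modulo PRINT{F4a, F4b} (Greenberg LNM 1716 §2) only (`2` split in `K` is DERIVED from the
habitat's Heegner hypothesis; every other binder is the habitat's / the frame's).  A NECESSARY condition (control side), displayed for the
census; it can exclude pinning at a datum, never supply it.  Stub set, names, signatures, every node and the composition UNCHANGED
(4 sorries = {U, R0G, PRINT-OV16, ACPIN}).  Nothing is proved about any curve; O2 / 19556 / 19218 OPEN.**

**v9.1 = v9 + §7 «ACPIN-NEC» (LEAD cruxlead-19556 g15, 2026-08-30; pen SUMMON @eb3ad7df8820a5a1, director-bsd (605)(r1)/(626)(a);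
event = audit-2 ADDENDUM-5 @1049a3e3c6ced77e «RS-DIAGONAL W⁺ / W⁺»): ONE import added (`…Theorems.TwoAdicConverseBDPSelmerLowerDivisibilityAtTwoAcPinNecessary`,
p781951) and the sorry-free §7 at the end — the audit's A5.2 algebra BY NAME: `FibrePinned G C'` ∧ `G(0,0) ∈ 𝔪_{𝒪_{ℂ₂}}` (the W⁺
READING «`G(0,0) = 4·unit`» at (1289a1 | 1913b1, ℚ(√−7)), `∈ 2⁴𝒪` at (113a1, ℚ(√−7))) ⟹ every primitive part `C₁` of `C'` has
`C₁(0,0) ∈ 𝔪` ⟹ `ch_{Λ_K}(X_Gr₂) ≠ (2^μ)` for every `μ` (`charIdeal_ne_span_two_pow_of_greenbergAcFibrePinningAt`, instantiated at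
the registered ACPIN datum predicate).  Stub set, stub names, stub signatures, every node and the composition are UNCHANGED
(4 sorries = {U, R0G, PRINT-OV16, ACPIN}); R0G's kill-switch (RS-DIAGONAL) did NOT fire — R0G stays RESEARCH, consistent at three
data, unprinted at 2; ACPIN carries the necessary condition above as a refutation handle.  Nothing is proved about any curve.**

**v9 «PRINT-NARROW» (LEAD cruxlead-19556 g14, 2026-08-30; pen GEN 36 WAKE @0d57cc139e5e27d5 (k1) + PEN ADDENDUM 1, director-bsd
(589)(v)/(599)(A)): Greenberg 1978 §4 for the split-prime line is now a KERNEL THEOREM** — conv-1 GEN 41 p777166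
`TwoAdicBDPSplitPrimeTorsion.greenberg1978_splitPrime_iwasawaModule_finite_torsion_holds :
Greenberg1978.splitPrime_iwasawaModule_finite_torsion` (the Literature Prop ITSELF, zero hypotheses; chain p776785 idelic characters →
p776845 line restrictions finite → p777166), displayed below BY NAME as `gr78_splitPrimeTorsion_holds`.  So v8's PRINT stub
`stub_gl1PrintFactsAtTwo : Gr78 §4 ∧ OV16 1.2` NARROWS to the ONE remaining GL(1) print fact at `p = 2`,
`stub_ovMuZeroPrintAtTwo : OukhabaViguie2016.thm12_splitPrime_muInvariant_eq_zero` (Oukhaba–Viguié 2016 Thm 1.2, `μ = 0` on the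
split-prime `ℤ₂`-line, ALL `p`; audited at 2, PASS ×2), and P4 `stub_trivialCharSplitLineFinite` is the sorry-free term
`fun K _ _ ↦ TwoAdicBDPEisensteinDevissage.trivialCharSplitLineFiniteAtTwo_of_muZero stub_ovMuZeroPrintAtTwo K` through conv-1's one-binder
wrapper (p777175 `…Theorems/TwoAdicConverseBDPSplitLineFiniteOfMuZero.lean`).  REGISTERED stubs v9 (the ONLY sorries of this file) =
{U `stub_upperInclusionRat`, R0G `stub_greenbergFunctionFree`, ACPIN `stub_acFibrePinning`} ∪ {PRINT `stub_ovMuZeroPrintAtTwo`}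
(3 research + 1 print = 4 ≤ stubs_max 4; OV16 stays a REGISTERED STUB, not a composition binder, because a Literature named-fact `def`
rides as a binder of the crux-headed theorem only when it is the signature of a ledger item — de Shalit II.4.17 = stmt-24085 is, OV16 is
not yet: `skeleton.extra-hypothesis` otherwise).  ★ NODE v9 (sorry-free, ONE print binder fewer than v8):
`bdpSelmerLowerDivisibilityAtTwo_of_katzSheet_of_ovPrint_of_acPin : thmII417 → OV16 1.2 → U → R0G → ACPIN → O2` (= the v8 node with
`hGr := gr78_splitPrimeTorsion_holds`; the v8 node is kept by name).  The composition `BDPSelmerLowerDivisibilityAtTwo_of (hKatz)` is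
unchanged text.  COUNT OF RECORD: O2 ⟸ PRINT{dS II.4.17 (item 24085); OV16 1.2} ∪ RESEARCH{U, R0G, ACPIN}; KERNEL: P0, S, PIN,
CONTENT, COFGEN₂, the tower→line doors, FD, P2, P3, P5, hdec, **hGr = Gr78 §4**; P4 + P1 FIN-SPLIT(β) proved mod {OV16} only.
Research residue UNCHANGED (U, R0G, ACPIN; riders as in v8).  HONESTY: BSD is proved for no curve; O2 / 19556 / 19218 stay OPEN;
typed ≠ proved; Gr78 §4 in the kernel is a formalised PRINTED theorem (beyond print: no); after v9 THREE research stubs and TWO print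
facts stand between this line and O2.

**v8 (LEAD cruxlead-19556 g13, 2026-08-30; pen GEN 36 WAKE @0a1fbd9edaec0f0c (k1′) = RC-619, director-bsd (580)(ii)/(586)(C)): the
RE-CUT after the split-prime line LANDED.**  Four of v7's seven stubs are now THEOREMS in the tree and are DISCHARGED BY NAME here
(the `stub_` names are kept, sorry-free, as the record): P2 `stub_splitPrimePairExists` := `TwoAdicBDPSplitPrimePair.splitPrimePairExistsAt_two`
(conv-1 GEN 39, p772855); P3 `stub_torsionResidueTransport` := `TwoAdicBDPPairTransport.torsionResidueTransportAt_two` (tower-1 GEN 49,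
p775605 — UNCONDITIONAL, no named fact); P5 `stub_eisensteinDevissage` := `TwoAdicBDPEisensteinDevissage.eisensteinDevissageAt_two`
(conv-1 GEN 40, p775208); P4 `stub_trivialCharSplitLineFinite` := `TwoAdicBDPEisensteinDevissage.trivialCharSplitLineFiniteAtTwo_of_twoPrintFacts`
(t42 GEN 36 p774822 + conv-1 GEN 40 p775363/p775402: the third binder `hdec` = de Shalit II.1.9(iii) is the kernel theorem
`TwoAdicBDPSplitLineDecomposition.deShalit1987_propII19iii_holds`) MODULO TWO PRINT FACTS at `p = 2`: Greenberg 1978 §4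
(`Greenberg1978.splitPrime_iwasawaModule_finite_torsion`: `X_∞` over the `v`-ramified `ℤ_p`-line of an imaginary quadratic field is
f.g. `Λ`-torsion, all `p`) and Oukhaba–Viguié 2016 Thm 1.2 (`OukhabaViguie2016.thm12_splitPrime_muInvariant_eq_zero`: its `μ = 0`, ALL `p`).
HOW THE TWO PRINT FACTS RIDE (gate rule, not taste): the skeleton audit admits as hypotheses of the crux-headed composition ONLY registered
obligations (route items such as `KatzSheetTwoVariablePrint` = stmt-24085, or declared stubs); a bare Literature `def … : Prop` binder is
`skeleton.extra-hypothesis`.  So the pair is carried as ONE registered PRINT stub `stub_gl1PrintFactsAtTwo : Gr78 §4 ∧ OV16 1.2` (by NAME,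
no restatement; it narrows to OV16 alone the day conv-1's kernel discharge of Gr78 §4 lands, and disappears if the planner files the pair
as print-leaf items like 24085), and P4 is the sorry-free term `trivialCharSplitLineFinite_of_twoPrintFacts stub_gl1PrintFactsAtTwo.1 ….2`.
REGISTERED stubs v8 (the ONLY sorries of this file) = {U `stub_upperInclusionRat`, R0G `stub_greenbergFunctionFree`, ACPIN
`stub_acFibrePinning`} ∪ {PRINT `stub_gl1PrintFactsAtTwo`} (3 research + 1 print = 4 ≤ stubs_max 4).  ★ NODE v8 (sorry-free, the two
print facts and de Shalit II.4.17 DISPLAYED as binders): `bdpSelmerLowerDivisibilityAtTwo_of_katzSheet_of_printFacts_of_acPin :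
thmII417 → Gr78 §4 → OV16 1.2 → U → R0G → ACPIN → O2`; the composition `BDPSelmerLowerDivisibilityAtTwo_of (hKatz)` is unchanged
text and now rests on exactly the four registered stubs.  COUNT OF RECORD: O2 ⟸ PRINT{dS II.4.17; Gr78 §4; OV16 1.2} ∪ RESEARCH{U, R0G,
ACPIN}; KERNEL: P0, S, PIN, CONTENT, COFGEN₂, the tower→line doors, FD, P2, P3, P5, hdec.  Riders (pen INBOX l.2467, audit-2 ADDENDUM-4):
R0G is INSTRUMENT-FALSIFIABLE (eng-2 WAKE #6 «RS-DIAGONAL»: `v₂(Λ(ξ_{n,n}))` at the diagonal CM points of 1289a1/1913b1 over `ℚ(√−7)`,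
prediction `+1` keeps O2-as-typed, `−1` refutes it at the datum) — no worker effort on R0G's content before that table is read; ACPIN's
statement is unchanged, its candidate witnesses (`Ideas/heegner-carrier-two`, `…/split-prime-edge-pinning-two`, `…/cyclotomic-prime-pinning-two`)
and R0G's candidate cut (`…/greenberg-object-content-two`) are recorded on the card, NONE adopted here.
HONESTY: BSD is proved for no curve; O2 / 19556 / 19218 stay OPEN; typed ≠ proved; after v8 THREE research stubs and THREE print facts
stand between this line and O2.

**v7 (LEAD cruxlead-19556 g12, same session; pen RC-590/RC-591, director-bsd (556)(C)(i): the «split-prime line» SWAP of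
crux-ideate seat 2 GEN 6 (`Lines/split_prime_line_finite_two.lean`, commit 75bfcda80282) ADOPTED.**  v6's research stub
FINLINE₂ `stub_lineFinite` — finite `2`-torsion of Greenberg's BDP-type Selmer group on EVERY in-frame `ℤ₂`-line, which the
node used only for the two PAIR-INDEPENDENT consequences «`X_Gr₂` is `Λ_K`-torsion» and «`red(toUnr₂ J C₀) ≠ 0`» (my own
CAVEAT: over-strong by the exceptional lines) — is REPLACED by exactly those consequences, `TorsionResidueForallAt W K`, supplied
by seat 2's KERNEL seam `torsionResidueForall_of_splitLine` from THREE pieces on the ONE `ℤ₂`-line where GL(1) theory is in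
print at `2`, the line `K_∞^{(v)} ⊂ K(v^∞)` RAMIFIED ONLY AT the relaxed prime `v`: P1 `SplitPrimeLineSelmerFiniteAt` (FIN-LINE on
that line only) ⟸ P4 `stub_trivialCharSplitLineFinite` (GL(1) PRINT leaf: the same BDP-type Selmer set for the TRIVIAL
character `ℚ₂/ℤ₂` over `K_∞^{(v)}` has finite `2`-torsion — Oukhaba–Viguié 2016 Thm 1.2 `μ = 0` for ALL `p`, Greenberg 1978
torsion, Choi–Kezuka–Li 2019 `X_∞ = 0` for `ℚ(√−7)`; a stub until the typer vendors it, then an admissible named hypothesis like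
the Katz sheet) ∧ P5 `stub_eisensteinDevissage` (kernel: on (β) `0 → 𝟙 → E[2] → 𝟙 → 0` bounds FIN-LINE by the trivial-character
set twice); P2 `stub_splitPrimePairExists` (CFT: that line extends to an adapted pair); P3 `stub_torsionResidueTransport`
(PAIR-TRANSPORT₂, tower-1 GEN 49 key: torsion and residual non-vanishing pass between adapted pairs of the same `K̃_∞`).
REGISTERED stubs v7 (the ONLY sorries) = {U `stub_upperInclusionRat`, R0G `stub_greenbergFunctionFree`, ACPIN
`stub_acFibrePinning`, P2, P3, P4, P5} (7 ≤ 7); seat 2's decls are copied VERBATIM (§SPLIT); v6's FINLINE₂ survives as a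
sorry-free STRONGER road (`torsionResidueForallAt_of_lineSelmerFinite`), no longer a stub.  ★ NODE v7:
`bdpSelmerLowerDivisibilityAtTwo_of_katzSheet_of_splitLine_of_acPin : thmII417 → U → R0G → P2 → P3 → P4 → P5 → ACPIN → O2`.

**v6 (LEAD cruxlead-19556 g12, 2026-08-30; pen RC-571 (k1), event (e1) = tower-1 GEN 47): the LINE OF RECORD re-cut after
the tower→line control theorem.**  The v5 research stub R0T `stub_frameTorsion` («an admissible Katz–Greenberg frame
`(Ω, δ, Ωp, LK, G)` exists at `2` ∧ `X_Gr(E/K̃_∞)` is `Λ_K`-torsion») is SPLIT: its `LK`-slot is PRINT (de Shalit II.4.17,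
`DeShalit1987.thmII417_exists_katzSheet`, carried BY NAME as the ledger's print leaf
`Theses.PrintCf2RubinValueTwo.KatzSheetTwoVariablePrint` = stmt-BirchSwinnertonDyer-24085), its `G`-slot is the research stub
R0G `stub_greenbergFunctionFree` (THE unprinted object at `2`), and its TORSION conjunct is now a THEOREM from ONE line:
`TwoAdicBDPTowerLineControl.xGr₂_baseChange_two_isTorsion_of_lineFinite` (tower-1 GEN 47, p769393) over COFGEN₂
(`TwoAdicBDPCofiniteGeneration.moduleFinite_xGr₂_baseChange_two`, tower-1 GEN 46 p768155 — UNCONDITIONAL, no hypothesis)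
and the tree's «`v̄` never splits completely in a `ℤ₂`-line of an imaginary quadratic field» (FD,
`ZpExtension.not_decomp_le_kerSubgroup_of_isImaginaryQuadratic`); the ONE line input is the new research stub FINLINE₂
`stub_lineFinite`: «Greenberg's Selmer group of `E[2^∞]` over the `κ₂`-LINE `K_∞^{(2)} = K̄^{ker κ₂}` (relaxed above `v`,
strict above `v̄`, unramified elsewhere) has finite `2`-torsion» (= its dual is `Λ`-torsion with `μ = 0`), VERBATIM the
type of the door's `hline`, universally quantified over the frame's binders exactly as the node consumes it.  The `μ₂ = 0`
clause `red(toUnr₂ J C₀) ≠ 0` is the twin door `…_map_residue_toUnr₂_ne_zero_of_lineFinite` (consumed on the RresEq road).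
CTRL₂ ∧ LINE₂ of v4.1/v5 DISAPPEAR (CTRL₂ verbatim for arbitrary pairs is heuristically FALSE on bad lines — tower-1
NOTE-CTRL2-GEN47 §1, evidence #35 on 24728 — and is itself a theorem under FD ∧ FINLINE₂: p769748
`ctrl₂_baseChange_two_of_lineFinite`); the v4 §LF annex (inner line) and the §CTRL annex are retired with them (they stay in
the v5 mirror `Cruxes/OrdLambdaHalfAtTwo/Lines/kato_determinant_greenberg_two_O2_gv_squeeze_v4.lean` @9ee16cb2f246).
REGISTERED research stubs (the ONLY sorries of this file) = {U `stub_upperInclusionRat`, R0G `stub_greenbergFunctionFree`,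
FINLINE₂ `stub_lineFinite`, ACPIN `stub_acFibrePinning`}; P0 / S / PIN / CONTENT / COFGEN₂ / TORSION / `μ₂ = 0` are KERNEL by
name.  ★ NODE v6: `bdpSelmerLowerDivisibilityAtTwo_of_katzSheet_of_lineFinite_of_acPin :
thmII417 → U → R0G → FINLINE₂ → ACPIN → O2` (PRINT binder displayed), twin `…_of_spanEq : thmII417 → U → R0G → FINLINE₂ →
RresEq → O2`; COMPOSITION `BDPSelmerLowerDivisibilityAtTwo_of (hKatz : KatzSheetTwoVariablePrint) : BDPSelmerLowerDivisibilityAtTwo`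
from the four stubs (the print is a registered obligation of the ledger, not a sorry of this file).  (k2) the sub-node
`greenbergAcFibrePinningAt_of_lineReading` / `acFibrePinningAtTwo_of_acLineReading`: ACPIN ⟸ ACLR♮ (N ∧ λ read through ONE
surjective residual line functional `φ : 𝔽̄₂⟦T₁,T₂⟧ → 𝔽̄₂⟦T⟧`, seat 2 g3/g4's seam in `order`-currency), PROVED, unregistered.
CAVEAT recorded (not hidden): FINLINE₂ as a `∀`-pairs statement asks torsion ∧ `μ = 0` on EVERY `ℤ₂`-line; the node needs
them only for the TWO-VARIABLE module (pair-independent), so the `∀`-form is stronger by exactly the (finitely many, if any)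
exceptional lines dividing `ch(X_Gr)` resp. `red ch(X_Gr)`; the weakening to «one line per `v̄`» needs a pair-transport
lemma for `XGr₂` (kernel task, not in the tree) — see the card §v6.
HONESTY: nothing here is proved about any curve; BSD is proved for no curve; O2 / 19556 / 19218 stay OPEN; typed ≠ proved.

History.  v5 (LEAD g11; pen RC-563 (B)(1)): Rres REPLACED by seat 1's ACPIN `stub_acFibrePinning` (crux idea
`anticyclotomic-fibre-pinning-two`: pin the cofactor at SOME prime `𝔓` of the special fibre `𝔽̄₂⟦T₁,T₂⟧` with (N)
`red G ∉ 𝔓` and (Λ) `red C₁ ∈ 𝔓 + (red G)`); kernel PIN/CONTENT by name (p768124); `Rres ⇒ ACPIN` proved; stubs {U, R0T,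
ACPIN}.  v4/v4.1 (LEAD g11): line of record re-cut to {U, R0T, Rres}; §LF/§KATZ/§CTRL annexes (tower-1 GEN 45/46, lead's
p767724/p767854).  v3 (seat 2 GEN 2): P0 `stub_charIdealPrincipal`, S `stub_gaussRigidity` KERNEL by name (p766476 /
p766427).  v2: R split into R0T ∧ Rres.  The crux decl is FIXED (imported from `…TwoAdicConverseOrdLambdaHalfAtTwoBDPTwoVariableDefs`),
never restated here; hypothesis-taking roads conclude the LOCAL ALIAS `O2Goal` so that `BDPSelmerLowerDivisibilityAtTwo_of` is
the UNIQUE crux-headed theorem for the skeleton audit (the file audit lists those roads as `orphan` by construction).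
-/

set_option linter.dupNamespace false
set_option autoImplicit false

noncomputable section

open scoped Classical NumberField
open WeierstrassCurve NumberField IsDedekindDomain Field CategoryTheory Function PowerSeries CongruenceSubgroup
open Literature.NumberTheory.EllipticCurves Literature.NumberTheory.EllipticCurves.Rank1Residual
open Literature.NumberTheory.EllipticCurves.ModularForms
open Literature.NumberTheory.GaloisRepresentations
open Literature.NumberTheory.EllipticCurves.IwasawaAlgebra₂ Literature.NumberTheory.EllipticCurves.UnrSeries₂
open Literature.NumberTheory.EllipticCurves.YanZhu2026
open Literature.NumberTheory.EllipticCurves.GreenbergSelmer Literature.NumberTheory.EllipticCurves.GreenbergVatsal2000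
open Literature.NumberTheory.EllipticCurves.Castella2018
open Summit.BirchSwinnertonDyer.BirchSwinnertonDyer.Theorems.TwoAdicKatoDeterminant
open Summit.BirchSwinnertonDyer.BirchSwinnertonDyer.Theorems.TwoAdicBDPTowerLineControl

namespace Summit.BirchSwinnertonDyer.BirchSwinnertonDyer.Cruxes.BDPSelmerLowerDivisibilityAtTwo.TwoVariableGvSqueezeTwo

/-- The coefficient ring of the analytic side at `2`: `𝒪_{ℂ₂}⟦T₁,T₂⟧` (home of `G`, `LK`, and of `toUnr₂ 2 J C`). -/
abbrev A₂ : Type := PowerSeries (PowerSeries (PadicComplexInt 2))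

/-- The RESIDUAL Iwasawa algebra `𝔽̄₂⟦T₁,T₂⟧` (`𝔽̄₂` = residue field of `𝒪_{ℂ₂}`): a 2-dimensional regular domain. -/
abbrev Ω₂ : Type := PowerSeries (PowerSeries (IsLocalRing.ResidueField (PadicComplexInt 2)))

/-- The residual LINE ring `𝔽̄₂⟦T⟧` (home of the one-line readings `φ (red₂ G)`; seat 2's `Ω₁`). -/
abbrev Ω₁ : Type := PowerSeries (IsLocalRing.ResidueField (PadicComplexInt 2))

/-- Coefficientwise reduction `𝒪_{ℂ₂}⟦T₁,T₂⟧ → 𝔽̄₂⟦T₁,T₂⟧` (reduction modulo the maximal ideal of `𝒪_{ℂ₂}`, NOT modulo `2`). -/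
def red₂ : A₂ →+* Ω₂ := PowerSeries.map (PowerSeries.map (IsLocalRing.residue (PadicComplexInt 2)))

/-- **O2 by name, as a LOCAL ALIAS** for the hypothesis-taking roads of this file (`… → O2Goal`), so that EXACTLY ONE theorem
(`BDPSelmerLowerDivisibilityAtTwo_of`) concludes the crux decl syntactically — the skeleton audit takes «the first» crux-headed
theorem in environment order.  Unfolds (reducibly) to `BDPSelmerLowerDivisibilityAtTwo`; nothing asserted. -/
abbrev O2Goal : Prop := BDPSelmerLowerDivisibilityAtTwo

/-! ## §1 The pieces at a datum `(W, K)` — binder for binder the frame of `GreenbergLowerInclusionAt W K` -/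

/-- **U at `(E,K)`** — the Euler-system-directional (UPPER) inclusion at `2` with `2`-power slack, for EVERY admissible
frame datum: `ch_{Λ_K}(X_Gr(E/K̃_∞))·𝒪_{ℂ₂}⟦T₁,T₂⟧ ∣ 2^m · G`. -/
def GreenbergUpperInclusionRatAt (W : WeierstrassCurve ℚ) [W.IsElliptic] [W.IsGloballyMinimal]
    (K : Type) [Field K] [NumberField K] : Prop :=
  ∀ [IsCMField K] (ι : PadicAlgCl 2 ≃+* ℂ) (v vbar : HeightOneSpectrum (𝓞 K)) (κ₁ κ₂ : ZpExtension K 2)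
    (γ₁ γ₂ : absoluteGaloisGroup K) [Fact (ZpExtension.IsTopGeneratorPair κ₁ κ₂ γ₁ γ₂)]
    [NeZero (W.conductorNorm ℤ)] (f : CuspForm (Gamma0 (W.conductorNorm ℤ)) 2),
    ModularForms.IsNewformOf W f → ∀ [NeZero (NumberField.discr K).natAbs],
    ((2 : ℕ) : 𝓞 K) ∈ v.asIdeal → ((2 : ℕ) : 𝓞 K) ∈ vbar.asIdeal → vbar ≠ v →
    (∀ (w : InfinitePlace K) (k : 𝓞 K), k ∈ v.asIdeal ↔ ‖ι.symm (w.embedding (k : K))‖ < 1) →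
    ∀ (Ω δ : ℂ) (Ωp : (unrIntegers 2)ˣ) (LK G : A₂),
      Ω ≠ 0 → (δ ^ 2 = (NumberField.discr K : ℂ) ∨ δ ^ 2 = -(NumberField.discr K : ℂ)) →
      IsKatzMeasure₂ ι v vbar ∅ κ₁ κ₂ γ₁⁻¹ γ₂⁻¹ 1 Ω δ ((Ωp : unrIntegers 2) : ℂ_[2]) LK →
      IsGreenbergLFunctionFree₂ ι v vbar κ₁ κ₂ γ₁⁻¹ γ₂⁻¹ f (NumberField.discr K).natAbs
        (NumberField.classNumber K) LK G →
      ∀ J : ℤ_[2] →+* PadicComplexInt 2,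
        (∀ x : ℤ_[2], ((J x : PadicComplexInt 2) : ℂ_[2]) = ((x : ℚ_[2]) : ℂ_[2])) →
        ∃ m : ℕ, Ideal.span {(2 : A₂) ^ m * G} ≤
          (WeierstrassCurve.XGr₂.charIdeal (W.baseChange K) 2 κ₁ κ₂ vbar γ₁ γ₂).map (toUnr₂ 2 J)

/-- **R at `(E,K)`** — the RESIDUAL (mod `𝔪_{𝒪_{ℂ₂}}`) two-variable equality at `2`: an admissible frame datum exists
with `X_Gr(E/K̃_∞)` `Λ_K`-torsion and, for every generator `C` of its characteristic ideal,
`red(C) ≠ 0` (`μ = 0`) and `red(G)·𝔽̄₂⟦T₁,T₂⟧ = red(C)·𝔽̄₂⟦T₁,T₂⟧`.  (Derived from R0T ∧ Rres; v1–v3's stub.) -/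
def GreenbergResidualEqualityAt (W : WeierstrassCurve ℚ) [W.IsElliptic] [W.IsGloballyMinimal]
    (K : Type) [Field K] [NumberField K] : Prop :=
  ∀ [IsCMField K] (ι : PadicAlgCl 2 ≃+* ℂ) (v vbar : HeightOneSpectrum (𝓞 K)) (κ₁ κ₂ : ZpExtension K 2)
    (γ₁ γ₂ : absoluteGaloisGroup K) [Fact (ZpExtension.IsTopGeneratorPair κ₁ κ₂ γ₁ γ₂)]
    [NeZero (W.conductorNorm ℤ)] (f : CuspForm (Gamma0 (W.conductorNorm ℤ)) 2),
    ModularForms.IsNewformOf W f → ∀ [NeZero (NumberField.discr K).natAbs],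
    ((2 : ℕ) : 𝓞 K) ∈ v.asIdeal → ((2 : ℕ) : 𝓞 K) ∈ vbar.asIdeal → vbar ≠ v →
    (∀ (w : InfinitePlace K) (k : 𝓞 K), k ∈ v.asIdeal ↔ ‖ι.symm (w.embedding (k : K))‖ < 1) →
    ∃ (Ω δ : ℂ) (Ωp : (unrIntegers 2)ˣ) (LK G : A₂),
      Ω ≠ 0 ∧ (δ ^ 2 = (NumberField.discr K : ℂ) ∨ δ ^ 2 = -(NumberField.discr K : ℂ)) ∧
      IsKatzMeasure₂ ι v vbar ∅ κ₁ κ₂ γ₁⁻¹ γ₂⁻¹ 1 Ω δ ((Ωp : unrIntegers 2) : ℂ_[2]) LK ∧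
      IsGreenbergLFunctionFree₂ ι v vbar κ₁ κ₂ γ₁⁻¹ γ₂⁻¹ f (NumberField.discr K).natAbs
        (NumberField.classNumber K) LK G ∧
      Module.IsTorsion (IwasawaAlgebra₂ 2) ((W.baseChange K).XGr₂ 2 κ₁ κ₂ vbar γ₁ γ₂) ∧
      ∀ J : ℤ_[2] →+* PadicComplexInt 2,
        (∀ x : ℤ_[2], ((J x : PadicComplexInt 2) : ℂ_[2]) = ((x : ℚ_[2]) : ℂ_[2])) →
        ∀ C : IwasawaAlgebra₂ 2,
          WeierstrassCurve.XGr₂.charIdeal (W.baseChange K) 2 κ₁ κ₂ vbar γ₁ γ₂ = Ideal.span {C} →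
          red₂ (toUnr₂ 2 J C) ≠ 0 ∧ Ideal.span {red₂ G} = Ideal.span {red₂ (toUnr₂ 2 J C)}

/-- **P0 at `(E,K)`** — principality of the two-variable characteristic ideal of a torsion `X_Gr(E/K̃_∞)` (pure algebra:
`ℤ₂⟦T₁,T₂⟧` is a UFD; kernel since tower-1 GEN 44). -/
def XGr₂CharIdealPrincipalAt (W : WeierstrassCurve ℚ) [W.IsElliptic] [W.IsGloballyMinimal]
    (K : Type) [Field K] [NumberField K] : Prop :=
  ∀ (vbar : HeightOneSpectrum (𝓞 K)) (κ₁ κ₂ : ZpExtension K 2) (γ₁ γ₂ : absoluteGaloisGroup K)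
    [Fact (ZpExtension.IsTopGeneratorPair κ₁ κ₂ γ₁ γ₂)],
    Module.IsTorsion (IwasawaAlgebra₂ 2) ((W.baseChange K).XGr₂ 2 κ₁ κ₂ vbar γ₁ γ₂) →
    ∃ C : IwasawaAlgebra₂ 2, WeierstrassCurve.XGr₂.charIdeal (W.baseChange K) 2 κ₁ κ₂ vbar γ₁ γ₂ = Ideal.span {C}

/-- **S — Gauss rigidity over `𝒪_{ℂ₂}⟦T₁,T₂⟧`** (pure commutative algebra; the SEAM of the squeeze; kernel since tower-1
GEN 44): if `C ∣ 2^m·G`, `red(C) ≠ 0` and `red(G) ≐ red(C)`, then `G ∣ C`. -/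
def GaussRigidity₂ : Prop :=
  ∀ (C G h : A₂) (m : ℕ), (2 : A₂) ^ m * G = C * h → red₂ C ≠ 0 →
    Ideal.span {red₂ G} = Ideal.span {red₂ C} → Ideal.span {C} ≤ Ideal.span {G}

/-- **R0T at `(E,K)`** — OBJECT half of R: an admissible frame datum `(Ω, δ, Ωp, LK, G)` exists at `2` (`LK` IS the
Katz measure, `G` IS `𝓛_2^Gr(E/K)` in the coordinate-free frame) and `X_Gr(E/K̃_∞)` is `Λ_K`-torsion — O2's own
`∃`-frame plus its torsion conjunct.  v6/v7: NO LONGER a stub — DERIVED from PRINT{de Shalit II.4.17} ∧ R0G ∧ (TORSION ∧ RESIDUE)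
(`greenbergFrameTorsionAt_of_frame_of_torsionResidue`; v6 road `…_of_lineSelmerFinite`; tower-1 GEN 46/47 by name). -/
def GreenbergFrameTorsionAt (W : WeierstrassCurve ℚ) [W.IsElliptic] [W.IsGloballyMinimal]
    (K : Type) [Field K] [NumberField K] : Prop :=
  ∀ [IsCMField K] (ι : PadicAlgCl 2 ≃+* ℂ) (v vbar : HeightOneSpectrum (𝓞 K)) (κ₁ κ₂ : ZpExtension K 2)
    (γ₁ γ₂ : absoluteGaloisGroup K) [Fact (ZpExtension.IsTopGeneratorPair κ₁ κ₂ γ₁ γ₂)]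
    [NeZero (W.conductorNorm ℤ)] (f : CuspForm (Gamma0 (W.conductorNorm ℤ)) 2),
    ModularForms.IsNewformOf W f → ∀ [NeZero (NumberField.discr K).natAbs],
    ((2 : ℕ) : 𝓞 K) ∈ v.asIdeal → ((2 : ℕ) : 𝓞 K) ∈ vbar.asIdeal → vbar ≠ v →
    (∀ (w : InfinitePlace K) (k : 𝓞 K), k ∈ v.asIdeal ↔ ‖ι.symm (w.embedding (k : K))‖ < 1) →
    ∃ (Ω δ : ℂ) (Ωp : (unrIntegers 2)ˣ) (LK G : A₂),
      Ω ≠ 0 ∧ (δ ^ 2 = (NumberField.discr K : ℂ) ∨ δ ^ 2 = -(NumberField.discr K : ℂ)) ∧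
      IsKatzMeasure₂ ι v vbar ∅ κ₁ κ₂ γ₁⁻¹ γ₂⁻¹ 1 Ω δ ((Ωp : unrIntegers 2) : ℂ_[2]) LK ∧
      IsGreenbergLFunctionFree₂ ι v vbar κ₁ κ₂ γ₁⁻¹ γ₂⁻¹ f (NumberField.discr K).natAbs
        (NumberField.classNumber K) LK G ∧
      Module.IsTorsion (IwasawaAlgebra₂ 2) ((W.baseChange K).XGr₂ 2 κ₁ κ₂ vbar γ₁ γ₂)

/-- **Rres at `(E,K)`** — RESIDUAL half of R, for EVERY admissible frame datum (the `∀`-frame of U): `μ = 0` for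
`ch(X_Gr)` read in `𝒪_{ℂ₂}⟦T₁,T₂⟧` and the residual divisor equality `(red G) = (red C)` in `𝔽̄₂⟦T₁,T₂⟧`. -/
def GreenbergResidualEqualityForallAt (W : WeierstrassCurve ℚ) [W.IsElliptic] [W.IsGloballyMinimal]
    (K : Type) [Field K] [NumberField K] : Prop :=
  ∀ [IsCMField K] (ι : PadicAlgCl 2 ≃+* ℂ) (v vbar : HeightOneSpectrum (𝓞 K)) (κ₁ κ₂ : ZpExtension K 2)
    (γ₁ γ₂ : absoluteGaloisGroup K) [Fact (ZpExtension.IsTopGeneratorPair κ₁ κ₂ γ₁ γ₂)]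
    [NeZero (W.conductorNorm ℤ)] (f : CuspForm (Gamma0 (W.conductorNorm ℤ)) 2),
    ModularForms.IsNewformOf W f → ∀ [NeZero (NumberField.discr K).natAbs],
    ((2 : ℕ) : 𝓞 K) ∈ v.asIdeal → ((2 : ℕ) : 𝓞 K) ∈ vbar.asIdeal → vbar ≠ v →
    (∀ (w : InfinitePlace K) (k : 𝓞 K), k ∈ v.asIdeal ↔ ‖ι.symm (w.embedding (k : K))‖ < 1) →
    ∀ (Ω δ : ℂ) (Ωp : (unrIntegers 2)ˣ) (LK G : A₂),
      Ω ≠ 0 → (δ ^ 2 = (NumberField.discr K : ℂ) ∨ δ ^ 2 = -(NumberField.discr K : ℂ)) →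
      IsKatzMeasure₂ ι v vbar ∅ κ₁ κ₂ γ₁⁻¹ γ₂⁻¹ 1 Ω δ ((Ωp : unrIntegers 2) : ℂ_[2]) LK →
      IsGreenbergLFunctionFree₂ ι v vbar κ₁ κ₂ γ₁⁻¹ γ₂⁻¹ f (NumberField.discr K).natAbs
        (NumberField.classNumber K) LK G →
      ∀ J : ℤ_[2] →+* PadicComplexInt 2,
        (∀ x : ℤ_[2], ((J x : PadicComplexInt 2) : ℂ_[2]) = ((x : ℚ_[2]) : ℂ_[2])) →
        ∀ C : IwasawaAlgebra₂ 2,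
          WeierstrassCurve.XGr₂.charIdeal (W.baseChange K) 2 κ₁ κ₂ vbar γ₁ γ₂ = Ideal.span {C} →
          red₂ (toUnr₂ 2 J C) ≠ 0 ∧ Ideal.span {red₂ G} = Ideal.span {red₂ (toUnr₂ 2 J C)}

/-- **R0F at `(E,K)`** — the pure OBJECT: an admissible Katz–Greenberg frame datum `(Ω, δ, Ωp, LK, G)` exists at `2` for
every adapted pair (no Selmer clause).  `LK` PRINT (de Shalit II.4.17); `G` UNPRINTED at `2`. -/
def GreenbergFrameAt (W : WeierstrassCurve ℚ) [W.IsElliptic] [W.IsGloballyMinimal]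
    (K : Type) [Field K] [NumberField K] : Prop :=
  ∀ [IsCMField K] (ι : PadicAlgCl 2 ≃+* ℂ) (v vbar : HeightOneSpectrum (𝓞 K)) (κ₁ κ₂ : ZpExtension K 2)
    (γ₁ γ₂ : absoluteGaloisGroup K) [Fact (ZpExtension.IsTopGeneratorPair κ₁ κ₂ γ₁ γ₂)]
    [NeZero (W.conductorNorm ℤ)] (f : CuspForm (Gamma0 (W.conductorNorm ℤ)) 2),
    ModularForms.IsNewformOf W f → ∀ [NeZero (NumberField.discr K).natAbs],
    ((2 : ℕ) : 𝓞 K) ∈ v.asIdeal → ((2 : ℕ) : 𝓞 K) ∈ vbar.asIdeal → vbar ≠ v →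
    (∀ (w : InfinitePlace K) (k : 𝓞 K), k ∈ v.asIdeal ↔ ‖ι.symm (w.embedding (k : K))‖ < 1) →
    ∃ (Ω δ : ℂ) (Ωp : (unrIntegers 2)ˣ) (LK G : A₂),
      Ω ≠ 0 ∧ (δ ^ 2 = (NumberField.discr K : ℂ) ∨ δ ^ 2 = -(NumberField.discr K : ℂ)) ∧
      IsKatzMeasure₂ ι v vbar ∅ κ₁ κ₂ γ₁⁻¹ γ₂⁻¹ 1 Ω δ ((Ωp : unrIntegers 2) : ℂ_[2]) LK ∧
      IsGreenbergLFunctionFree₂ ι v vbar κ₁ κ₂ γ₁⁻¹ γ₂⁻¹ f (NumberField.discr K).natAbs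
        (NumberField.classNumber K) LK G

/-- **R0G at `(E,K)`** — the two-variable Greenberg series RELATIVE to a Katz datum: for every embedding datum, adapted
pair and admissible Katz datum `(Ω, δ, Ωp, LK)`, some `G ∈ 𝒪_{ℂ₂}⟦T₁,T₂⟧` IS `𝓛_2^Gr(E/K)` in the coordinate-free frame.
THE unprinted object at `2` (Castella–Hsieh / CGS / BSTW construct it for `p` odd; Kriz–Li at `2` is value-level). -/
def GreenbergObjectAt (W : WeierstrassCurve ℚ) [W.IsElliptic] [W.IsGloballyMinimal]
    (K : Type) [Field K] [NumberField K] : Prop :=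
  ∀ [IsCMField K] (ι : PadicAlgCl 2 ≃+* ℂ) (v vbar : HeightOneSpectrum (𝓞 K)) (κ₁ κ₂ : ZpExtension K 2)
    (γ₁ γ₂ : absoluteGaloisGroup K) [Fact (ZpExtension.IsTopGeneratorPair κ₁ κ₂ γ₁ γ₂)]
    [NeZero (W.conductorNorm ℤ)] (f : CuspForm (Gamma0 (W.conductorNorm ℤ)) 2),
    ModularForms.IsNewformOf W f → ∀ [NeZero (NumberField.discr K).natAbs],
    ((2 : ℕ) : 𝓞 K) ∈ v.asIdeal → ((2 : ℕ) : 𝓞 K) ∈ vbar.asIdeal → vbar ≠ v →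
    (∀ (w : InfinitePlace K) (k : 𝓞 K), k ∈ v.asIdeal ↔ ‖ι.symm (w.embedding (k : K))‖ < 1) →
    ∀ (Ω δ : ℂ) (Ωp : (unrIntegers 2)ˣ) (LK : A₂),
      Ω ≠ 0 → (δ ^ 2 = (NumberField.discr K : ℂ) ∨ δ ^ 2 = -(NumberField.discr K : ℂ)) →
      IsKatzMeasure₂ ι v vbar ∅ κ₁ κ₂ γ₁⁻¹ γ₂⁻¹ 1 Ω δ ((Ωp : unrIntegers 2) : ℂ_[2]) LK →
      ∃ G : A₂, IsGreenbergLFunctionFree₂ ι v vbar κ₁ κ₂ γ₁⁻¹ γ₂⁻¹ f (NumberField.discr K).natAbs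
        (NumberField.classNumber K) LK G

/-- **FINLINE₂ at `(E,K)`** (v6; the ONE line input of tower-1 GEN 47, VERBATIM the type of `hline` in
`TwoAdicBDPTowerLineControl.xGr₂_baseChange_two_isTorsion_of_lineFinite`) — for the split primes `v ≠ v̄` over `2` and every
adapted pair `(κ₁, κ₂; γ₁, γ₂)`: Greenberg's Selmer group of `E[2^∞]` over the `κ₂`-LINE `K_∞^{(2)} = K̄^{ker κ₂}` with
Castella's BDP data at `v̄` (STRICT above `v̄`, RELAXED above `v`, unramified away from `2`; `Σ = ∅`) has FINITE `2`-torsion —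
equivalently its Pontryagin dual is `Λ`-torsion with `μ = 0`.  For `κ₂` anticyclotomic this is the BDP/Greenberg
anticyclotomic Selmer group at `2` (print siblings `p` odd: cotorsion by Castella/BCK, `μ = 0` by Hsieh/Burungale).
STRONGER than the node needs by the exceptional lines (those `ℤ₂`-lines whose linear form divides `ch(X_Gr)` or its
reduction; finitely many if any) — see the module docstring's CAVEAT. -/
def XGr₂LineSelmerFiniteAt (W : WeierstrassCurve ℚ) [W.IsElliptic] [W.IsGloballyMinimal]
    (K : Type) [Field K] [NumberField K] : Prop :=
  ∀ (v vbar : HeightOneSpectrum (𝓞 K)) (κ₁ κ₂ : ZpExtension K 2) (γ₁ γ₂ : absoluteGaloisGroup K)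
    [Fact (ZpExtension.IsTopGeneratorPair κ₁ κ₂ γ₁ γ₂)],
    ((2 : ℕ) : 𝓞 K) ∈ v.asIdeal → ((2 : ℕ) : 𝓞 K) ∈ vbar.asIdeal → vbar ≠ v →
    Set.Finite {t : (W.baseChange K).subgroupH1 2 κ₂.kerSubgroup |
      t ∈ GreenbergVatsal2000.datumSelmerInfty κ₂ ((W.baseChange K).geomPrimaryTorsion 2)
            (Castella2018.AcSelmer.bdpData ((W.baseChange K).geomPrimaryTorsion 2) 2 vbar) ∅ ∧ 2 • t = 0}

/-- **COFGEN₂ at `(E,K)`** — `X_Gr(E/K̃_∞)` is finitely generated over `Λ_K = Λ₂` (a THEOREM since tower-1 GEN 46: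
`xGr₂Cofg_holds` below; kept as a named piece for the card). -/
def XGr₂CofgAt (W : WeierstrassCurve ℚ) [W.IsElliptic] [W.IsGloballyMinimal]
    (K : Type) [Field K] [NumberField K] : Prop :=
  ∀ (v vbar : HeightOneSpectrum (𝓞 K)) (κ₁ κ₂ : ZpExtension K 2) (γ₁ γ₂ : absoluteGaloisGroup K)
    [Fact (ZpExtension.IsTopGeneratorPair κ₁ κ₂ γ₁ γ₂)],
    ((2 : ℕ) : 𝓞 K) ∈ v.asIdeal → ((2 : ℕ) : 𝓞 K) ∈ vbar.asIdeal → vbar ≠ v →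
    Module.Finite (IwasawaAlgebra₂ 2) ((W.baseChange K).XGr₂ 2 κ₁ κ₂ vbar γ₁ γ₂)

/-! ### §SPLIT (v7; crux-ideate seat 2 GEN 6 `Lines/split_prime_line_finite_two.lean` @75bfcda80282, decls VERBATIM):
what the node consumes per pair, the v-RAMIFIED line, pair transport, the GL(1) print leaf and the Eisenstein dévissage -/

/-- `κ` is RAMIFIED ONLY INSIDE `S`: every inertia group of `Γ_K` at a finite place outside `S` lies in `ker κ`
(for `S = {v}`, `K` imaginary quadratic, `2 = v v̄`: `K̄^{ker κ}` is the ℤ₂-extension `K_∞^{(v)} ⊂ K(v^∞)`). (seat 2, verbatim) -/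
def RamifiedOnlyIn {K : Type} [Field K] [NumberField K] {p : ℕ} [Fact p.Prime] (κ : ZpExtension K p)
    (S : Set (HeightOneSpectrum (𝓞 K))) : Prop :=
  Literature.NumberTheory.FaltingsSerre.inertiaOutside K S ⊆
    ((κ.kerSubgroup : Subgroup (Field.absoluteGaloisGroup K)) : Set (Field.absoluteGaloisGroup K))

/-- FIN-LINE(κ₂; v̄) — VERBATIM the v6 stub's datum (the type of the door's `hline`): the 2-torsion of Greenberg's Selmer
group of `E[2^∞]` over `K̄^{ker κ₂}`, strict above `v̄`, relaxed at the other prime above 2, `S₀ = ∅`, is finite.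
Depends on `(κ₂, v̄)` only. (seat 2, verbatim) -/
def LineSelmerTwoTorsionFinite (W : WeierstrassCurve ℚ) [W.IsElliptic] (K : Type) [Field K] [NumberField K]
    (κ₂ : ZpExtension K 2) (vbar : HeightOneSpectrum (𝓞 K)) : Prop :=
  Set.Finite {t : (W.baseChange K).subgroupH1 2 κ₂.kerSubgroup |
    t ∈ datumSelmerInfty κ₂ ((W.baseChange K).geomPrimaryTorsion 2)
      (AcSelmer.bdpData ((W.baseChange K).geomPrimaryTorsion 2) 2 vbar) ∅ ∧ 2 • t = 0}

/-- **P1 FIN-SPLIT** (reduced to PRINT P4 ∧ kernel P5 below): FIN-LINE at every line `κ₂` ramified only at the relaxed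
prime `v`. (seat 2, verbatim) -/
def SplitPrimeLineSelmerFiniteAt (W : WeierstrassCurve ℚ) [W.IsElliptic] (K : Type) [Field K] [NumberField K] :
    Prop :=
  IsImaginaryQuadratic K → ∀ (v vbar : HeightOneSpectrum (𝓞 K)) (κ₂ : ZpExtension K 2), ((2 : ℕ) : 𝓞 K) ∈ v.asIdeal →
    ((2 : ℕ) : 𝓞 K) ∈ vbar.asIdeal → vbar ≠ v → RamifiedOnlyIn κ₂ {v} → LineSelmerTwoTorsionFinite W K κ₂ vbar

/-- **P2 SPLIT-PAIR-EXISTS** (ATTACKABLE, GL(1)/CFT): for `2 = v v̄` split in `K` there is an adapted pair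
`(κ₁, κ₂; γ₁, γ₂)` whose second line is ramified only at `v` (the ℤ₂-quotient of `Gal(K(v^∞)/K)`, a PRIMITIVE element of
`Hom(Gal(K̃_∞/K), ℤ₂)`, extended to a basis — `κ₁` need not be `κ_{v̄}`). (seat 2, verbatim) -/
def SplitPrimePairExistsAt (K : Type) [Field K] [NumberField K] : Prop :=
  IsImaginaryQuadratic K → ∀ (v vbar : HeightOneSpectrum (𝓞 K)), ((2 : ℕ) : 𝓞 K) ∈ v.asIdeal → ((2 : ℕ) : 𝓞 K) ∈ vbar.asIdeal → vbar ≠ v →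
    ∃ (κ₁ κ₂ : ZpExtension K 2) (γ₁ γ₂ : Field.absoluteGaloisGroup K),
      ZpExtension.IsTopGeneratorPair κ₁ κ₂ γ₁ γ₂ ∧ RamifiedOnlyIn κ₂ {v}

/-- The residual non-vanishing of a generator `C₀` of `ch_{Λ_K}(X_Gr₂)` along `J : ℤ₂ → 𝒪_{ℂ₂}` (the `μ₂ = 0` clause; `= red₂ (toUnr₂ 2 J C₀) ≠ 0`
by `rfl`). (seat 2, verbatim) -/
def ResidueNonvanishing (J : ℤ_[2] →+* PadicComplexInt 2) (C₀ : IwasawaAlgebra₂ 2) : Prop :=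
  PowerSeries.map (PowerSeries.map (IsLocalRing.residue (PadicComplexInt 2))) (IwasawaAlgebra₂.toUnr₂ 2 J C₀) ≠ 0

/-- **TORSION ∧ RESIDUE at every adapted pair** — exactly the two consequences the v6 node drew from `stub_lineFinite`; the v7
node consumes THIS. (seat 2, verbatim) -/
def TorsionResidueForallAt (W : WeierstrassCurve ℚ) [W.IsElliptic] (K : Type) [Field K] [NumberField K] : Prop :=
  IsImaginaryQuadratic K → ∀ (v vbar : HeightOneSpectrum (𝓞 K)), ((2 : ℕ) : 𝓞 K) ∈ v.asIdeal → ((2 : ℕ) : 𝓞 K) ∈ vbar.asIdeal → vbar ≠ v →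
    ∀ (κ₁ κ₂ : ZpExtension K 2) (γ₁ γ₂ : Field.absoluteGaloisGroup K)
      [Fact (ZpExtension.IsTopGeneratorPair κ₁ κ₂ γ₁ γ₂)],
      Module.IsTorsion (IwasawaAlgebra₂ 2) ((W.baseChange K).XGr₂ 2 κ₁ κ₂ vbar γ₁ γ₂) ∧
        ∀ (J : ℤ_[2] →+* PadicComplexInt 2) (C₀ : IwasawaAlgebra₂ 2),
          WeierstrassCurve.XGr₂.charIdeal (W.baseChange K) 2 κ₁ κ₂ vbar γ₁ γ₂ = Ideal.span {C₀} →
            ResidueNonvanishing J C₀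

/-- **P3 PAIR-TRANSPORT₂** (ATTACKABLE kernel; the lead's W1, tower-1 GEN 49 key): torsion of `X_Gr₂` and residual non-vanishing
of its characteristic generators pass from one adapted pair `(κ₁', κ₂'; γ₁', γ₂')` to any other `(κ₁, κ₂; γ₁, γ₂)` at the same
strict prime `v̄` (same underlying `ℤ₂⟦Gal(K̃_∞/K)⟧`-module; only the `Λ_K`-coordinates change). (seat 2, verbatim) -/
def TorsionResidueTransportAt (W : WeierstrassCurve ℚ) [W.IsElliptic] (K : Type) [Field K] [NumberField K] : Prop :=
  IsImaginaryQuadratic K → ∀ (vbar : HeightOneSpectrum (𝓞 K)), ((2 : ℕ) : 𝓞 K) ∈ vbar.asIdeal →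
    ∀ (κ₁ κ₂ κ₁' κ₂' : ZpExtension K 2) (γ₁ γ₂ γ₁' γ₂' : Field.absoluteGaloisGroup K)
      [Fact (ZpExtension.IsTopGeneratorPair κ₁ κ₂ γ₁ γ₂)] [Fact (ZpExtension.IsTopGeneratorPair κ₁' κ₂' γ₁' γ₂')],
      (Module.IsTorsion (IwasawaAlgebra₂ 2) ((W.baseChange K).XGr₂ 2 κ₁' κ₂' vbar γ₁' γ₂') →
          Module.IsTorsion (IwasawaAlgebra₂ 2) ((W.baseChange K).XGr₂ 2 κ₁ κ₂ vbar γ₁ γ₂)) ∧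
        ((∀ (J : ℤ_[2] →+* PadicComplexInt 2) (C₀ : IwasawaAlgebra₂ 2),
            WeierstrassCurve.XGr₂.charIdeal (W.baseChange K) 2 κ₁' κ₂' vbar γ₁' γ₂' = Ideal.span {C₀} →
              ResidueNonvanishing J C₀) →
          ∀ (J : ℤ_[2] →+* PadicComplexInt 2) (C₀ : IwasawaAlgebra₂ 2),
            WeierstrassCurve.XGr₂.charIdeal (W.baseChange K) 2 κ₁ κ₂ vbar γ₁ γ₂ = Ideal.span {C₀} →
              ResidueNonvanishing J C₀)

/-- The TRIVIAL GL₁ character module `ℚ₂/ℤ₂` of `Γ_K`, as the Keller–Yin carrier `(F/𝒪)(θ)` at `θ = 1`, `S = ∅`. (seat 2, verbatim) -/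
abbrev TrivCharModule (K : Type) [Field K] [NumberField K] : Type :=
  KellerYin2024.charModule (∅ : Set (PadicAlgCl 2))
    (1 : FramedGaloisRep K (padicCoeffIntegers (∅ : Set (PadicAlgCl 2))) 1)

/-- **P4 GL1-FIN** (PRINT + elementary): over every line `κ` ramified only at `v`, the BDP-type Selmer set of the trivial
character (strict = locally split above `v̄`, relaxed above `v`, relaxed at a finite `S₀`) has finite 2-torsion —
`Hom(𝔛, ℚ₂/ℤ₂)[2]` for a quotient `𝔛` of `Gal(M^{S₀ ∪ {v}}_∞/K_∞^{(v)})`, finitely generated over `ℤ₂` by Oukhaba–Viguié 2016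
Thm 1.2 (µ = 0, all `p`) + Greenberg 1978 (Λ-torsion) + pro-2 tame inertia at the finitely many places above `S₀` (every
`𝔮 ∤ v` is finitely decomposed in `K_∞^{(v)}`). [cite: arXiv:1311.3565, Thm 1.2] (seat 2, verbatim) -/
def TrivialCharSplitLineFiniteAt (K : Type) [Field K] [NumberField K] : Prop :=
  IsImaginaryQuadratic K → ∀ (v vbar : HeightOneSpectrum (𝓞 K)) (κ : ZpExtension K 2) (S₀ : Set (HeightOneSpectrum (𝓞 K))), S₀.Finite →
    ((2 : ℕ) : 𝓞 K) ∈ v.asIdeal → ((2 : ℕ) : 𝓞 K) ∈ vbar.asIdeal → vbar ≠ v → RamifiedOnlyIn κ {v} →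
    Set.Finite {t : subgroupH1 κ.kerSubgroup (TrivCharModule K) |
      t ∈ datumSelmerInfty κ (TrivCharModule K) (AcSelmer.bdpData (TrivCharModule K) 2 vbar) S₀ ∧ 2 • t = 0}

/-- **P5 DEV** (ATTACKABLE kernel Galois cohomology): on habitat (β) — `E[2]` reducible, i.e. a rational point of order 2, so
`0 → 𝟙 → E[2] → 𝟙 → 0` over `ℚ` — GL1-FIN bounds FIN-LINE on every v-ramified line (take `S₀` = the bad places; the
conditions above 2 are relaxed/strict, hence curve-independent; kernel bricks: the long exact sequence, `E(K_∞^{(v)})[2^∞]`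
finite, finitely many places above `v̄` and `S₀` on the line, and `finite_of_finite_image_of_finite_inter_ker`). (seat 2, verbatim) -/
def EisensteinDevissageAt (W : WeierstrassCurve ℚ) [W.IsElliptic] (K : Type) [Field K] [NumberField K] : Prop :=
  ¬ W.HasIrreducibleModPGaloisRep 2 → TrivialCharSplitLineFiniteAt K → SplitPrimeLineSelmerFiniteAt W K

/-- **RresEq at `(E,K)`** — the residual SPAN EQUALITY alone, for every admissible frame datum, every `J`, every
generator `C`: `(red₂ G) = (red₂ (toUnr₂ 2 J C))` in `𝔽̄₂⟦T₁,T₂⟧` (content R_alg ∧ R_KMC ∧ R_an; the `μ = 0` conjunct of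
Rres is supplied by the torsion/residue input).  The alternative (stronger) residual leaf to ACPIN; kept as a sorry-free road. -/
def GreenbergResidualSpanEqForallAt (W : WeierstrassCurve ℚ) [W.IsElliptic] [W.IsGloballyMinimal]
    (K : Type) [Field K] [NumberField K] : Prop :=
  ∀ [IsCMField K] (ι : PadicAlgCl 2 ≃+* ℂ) (v vbar : HeightOneSpectrum (𝓞 K)) (κ₁ κ₂ : ZpExtension K 2)
    (γ₁ γ₂ : absoluteGaloisGroup K) [Fact (ZpExtension.IsTopGeneratorPair κ₁ κ₂ γ₁ γ₂)]
    [NeZero (W.conductorNorm ℤ)] (f : CuspForm (Gamma0 (W.conductorNorm ℤ)) 2),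
    ModularForms.IsNewformOf W f → ∀ [NeZero (NumberField.discr K).natAbs],
    ((2 : ℕ) : 𝓞 K) ∈ v.asIdeal → ((2 : ℕ) : 𝓞 K) ∈ vbar.asIdeal → vbar ≠ v →
    (∀ (w : InfinitePlace K) (k : 𝓞 K), k ∈ v.asIdeal ↔ ‖ι.symm (w.embedding (k : K))‖ < 1) →
    ∀ (Ω δ : ℂ) (Ωp : (unrIntegers 2)ˣ) (LK G : A₂),
      Ω ≠ 0 → (δ ^ 2 = (NumberField.discr K : ℂ) ∨ δ ^ 2 = -(NumberField.discr K : ℂ)) →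
      IsKatzMeasure₂ ι v vbar ∅ κ₁ κ₂ γ₁⁻¹ γ₂⁻¹ 1 Ω δ ((Ωp : unrIntegers 2) : ℂ_[2]) LK →
      IsGreenbergLFunctionFree₂ ι v vbar κ₁ κ₂ γ₁⁻¹ γ₂⁻¹ f (NumberField.discr K).natAbs
        (NumberField.classNumber K) LK G →
      ∀ J : ℤ_[2] →+* PadicComplexInt 2,
        (∀ x : ℤ_[2], ((J x : PadicComplexInt 2) : ℂ_[2]) = ((x : ℚ_[2]) : ℂ_[2])) →
        ∀ C : IwasawaAlgebra₂ 2,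
          WeierstrassCurve.XGr₂.charIdeal (W.baseChange K) 2 κ₁ κ₂ vbar γ₁ γ₂ = Ideal.span {C} →
          Ideal.span {red₂ G} = Ideal.span {red₂ (toUnr₂ 2 J C)}

/-! ## §2 The pieces on the habitat of O2 -/

/-- U on the habitat (β): two-variable Euler-system divisibility at `2` up to powers of `2`. Research grade. -/
def TwoVariableUpperInclusionRatAtTwo : Prop :=
  ∀ (W : WeierstrassCurve ℚ) [W.IsElliptic] [W.IsGloballyMinimal],
    ¬ W.HasCM → GoodOrd W 2 → ¬ W.HasIrreducibleModPGaloisRep 2 →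
    ∀ (K : Type) [Field K] [NumberField K],
      (IsImaginaryQuadratic K ∧ SatisfiesHeegnerHypothesis (2 * W.conductorNorm ℤ) K) →
      GreenbergUpperInclusionRatAt W K

/-- R on the habitat (β): the residual two-variable Greenberg–Vatsal equality at `2` (derived from R0T ∧ Rres). -/
def TwoVariableResidualEqualityAtTwo : Prop :=
  ∀ (W : WeierstrassCurve ℚ) [W.IsElliptic] [W.IsGloballyMinimal],
    ¬ W.HasCM → GoodOrd W 2 → ¬ W.HasIrreducibleModPGaloisRep 2 →
    ∀ (K : Type) [Field K] [NumberField K],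
      (IsImaginaryQuadratic K ∧ SatisfiesHeegnerHypothesis (2 * W.conductorNorm ℤ) K) →
      GreenbergResidualEqualityAt W K

/-- P0 on the habitat. Kernel algebra. -/
def XGr₂CharIdealPrincipalAtTwo : Prop :=
  ∀ (W : WeierstrassCurve ℚ) [W.IsElliptic] [W.IsGloballyMinimal] (K : Type) [Field K] [NumberField K],
    XGr₂CharIdealPrincipalAt W K

/-- R0T on the habitat (β): the OBJECT half of R (v6: DERIVED, `frameTorsion_of_katzSheet_of_object_of_lineFinite`). -/
def TwoVariableFrameTorsionAtTwo : Prop :=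
  ∀ (W : WeierstrassCurve ℚ) [W.IsElliptic] [W.IsGloballyMinimal],
    ¬ W.HasCM → GoodOrd W 2 → ¬ W.HasIrreducibleModPGaloisRep 2 →
    ∀ (K : Type) [Field K] [NumberField K],
      (IsImaginaryQuadratic K ∧ SatisfiesHeegnerHypothesis (2 * W.conductorNorm ℤ) K) →
      GreenbergFrameTorsionAt W K

/-- Rres on the habitat (β): the RESIDUAL half of R (the v4.1 leaf; implies ACPIN). -/
def TwoVariableResidualEqualityForallAtTwo : Prop :=
  ∀ (W : WeierstrassCurve ℚ) [W.IsElliptic] [W.IsGloballyMinimal],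
    ¬ W.HasCM → GoodOrd W 2 → ¬ W.HasIrreducibleModPGaloisRep 2 →
    ∀ (K : Type) [Field K] [NumberField K],
      (IsImaginaryQuadratic K ∧ SatisfiesHeegnerHypothesis (2 * W.conductorNorm ℤ) K) →
      GreenbergResidualEqualityForallAt W K

/-- R0F on the habitat (β): the frame OBJECT at 2 (⟸ PRINT{thmII417} ∧ R0G, §KATZ). -/
def TwoVariableFrameAtTwo : Prop :=
  ∀ (W : WeierstrassCurve ℚ) [W.IsElliptic] [W.IsGloballyMinimal],
    ¬ W.HasCM → GoodOrd W 2 → ¬ W.HasIrreducibleModPGaloisRep 2 →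
    ∀ (K : Type) [Field K] [NumberField K],
      (IsImaginaryQuadratic K ∧ SatisfiesHeegnerHypothesis (2 * W.conductorNorm ℤ) K) →
      GreenbergFrameAt W K

/-- R0G on the habitat (β): the two-variable Greenberg series at `2` relative to every Katz datum.  Research (UNPRINTED). -/
def TwoVariableGreenbergObjectAtTwo : Prop :=
  ∀ (W : WeierstrassCurve ℚ) [W.IsElliptic] [W.IsGloballyMinimal],
    ¬ W.HasCM → GoodOrd W 2 → ¬ W.HasIrreducibleModPGaloisRep 2 →
    ∀ (K : Type) [Field K] [NumberField K],
      (IsImaginaryQuadratic K ∧ SatisfiesHeegnerHypothesis (2 * W.conductorNorm ℤ) K) →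
      GreenbergObjectAt W K

/-- FINLINE₂ on the habitat (β) (v6's stub; v7: a STRONGER sorry-free input, no longer registered): finite `2`-torsion of
Greenberg's BDP-type Selmer group over every in-frame `ℤ₂`-line.  Research at `2` (print siblings `p` odd). -/
def TwoVariableLineSelmerFiniteAtTwo : Prop :=
  ∀ (W : WeierstrassCurve ℚ) [W.IsElliptic] [W.IsGloballyMinimal],
    ¬ W.HasCM → GoodOrd W 2 → ¬ W.HasIrreducibleModPGaloisRep 2 →
    ∀ (K : Type) [Field K] [NumberField K],
      (IsImaginaryQuadratic K ∧ SatisfiesHeegnerHypothesis (2 * W.conductorNorm ℤ) K) →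
      XGr₂LineSelmerFiniteAt W K

/-- TORSION ∧ RESIDUE on the habitat (β) (v7: what the node consumes; DERIVED from P2 ∧ P3 ∧ P4 ∧ P5, or from FINLINE₂). -/
def TwoVariableTorsionResidueAtTwo : Prop :=
  ∀ (W : WeierstrassCurve ℚ) [W.IsElliptic] [W.IsGloballyMinimal],
    ¬ W.HasCM → GoodOrd W 2 → ¬ W.HasIrreducibleModPGaloisRep 2 →
    ∀ (K : Type) [Field K] [NumberField K],
      (IsImaginaryQuadratic K ∧ SatisfiesHeegnerHypothesis (2 * W.conductorNorm ℤ) K) →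
      TorsionResidueForallAt W K

/-- P2 SPLIT-PAIR-EXISTS for every number field (guarded inside by `IsImaginaryQuadratic K`; CFT, ATTACKABLE). -/
def SplitPrimePairExistsAtTwo : Prop :=
  ∀ (K : Type) [Field K] [NumberField K], SplitPrimePairExistsAt K

/-- P3 PAIR-TRANSPORT₂ for every elliptic `W/ℚ` and number field `K` (kernel, ATTACKABLE; tower-1 GEN 49 key). -/
def TorsionResidueTransportAtTwo : Prop :=
  ∀ (W : WeierstrassCurve ℚ) [W.IsElliptic] (K : Type) [Field K] [NumberField K], TorsionResidueTransportAt W K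

/-- P4 GL1-FIN for every number field (guarded inside by `IsImaginaryQuadratic K`; GL(1) PRINT leaf at `p = 2`). -/
def TrivialCharSplitLineFiniteAtTwo : Prop :=
  ∀ (K : Type) [Field K] [NumberField K], TrivialCharSplitLineFiniteAt K

/-- P5 DEV for every elliptic `W/ℚ` and number field `K` (kernel, ATTACKABLE; `¬ Irr E[2]` is a hypothesis inside). -/
def EisensteinDevissageAtTwo : Prop :=
  ∀ (W : WeierstrassCurve ℚ) [W.IsElliptic] (K : Type) [Field K] [NumberField K], EisensteinDevissageAt W K

/-- COFGEN₂ on the habitat (β) (a THEOREM: `twoVariableCofgAtTwo_holds`). -/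
def TwoVariableCofgAtTwo : Prop :=
  ∀ (W : WeierstrassCurve ℚ) [W.IsElliptic] [W.IsGloballyMinimal],
    ¬ W.HasCM → GoodOrd W 2 → ¬ W.HasIrreducibleModPGaloisRep 2 →
    ∀ (K : Type) [Field K] [NumberField K],
      (IsImaginaryQuadratic K ∧ SatisfiesHeegnerHypothesis (2 * W.conductorNorm ℤ) K) →
      XGr₂CofgAt W K

/-- RresEq on the habitat (β): the residual span equality (research; R_alg ∧ R_KMC ∧ R_an). -/
def TwoVariableResidualSpanEqualityAtTwo : Prop :=
  ∀ (W : WeierstrassCurve ℚ) [W.IsElliptic] [W.IsGloballyMinimal],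
    ¬ W.HasCM → GoodOrd W 2 → ¬ W.HasIrreducibleModPGaloisRep 2 →
    ∀ (K : Type) [Field K] [NumberField K],
      (IsImaginaryQuadratic K ∧ SatisfiesHeegnerHypothesis (2 * W.conductorNorm ℤ) K) →
      GreenbergResidualSpanEqForallAt W K

/-! ## §3 Registered stubs (v9): P0, S, PIN, CONTENT, P2, P3, P5, hGr KERNEL by name, P4 by name modulo the PRINT stub; the stubs U, R0G, ACPIN (research) and `stub_ovMuZeroPrintAtTwo` (print: OV16 1.2) are the ONLY sorries -/

/-- **stub P0** (kernel algebra): principality of `ch_{Λ_K}(X_Gr(E/K̃_∞))` — KERNEL since tower-1 GEN 44 (p766476):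
`ℤ₂⟦T₁,T₂⟧` is a UFD (`IwasawaTheory.uniqueFactorizationMonoid_iwasawaAlgebraTwoVar`); the torsion hypothesis is idle. -/
theorem stub_charIdealPrincipal : XGr₂CharIdealPrincipalAtTwo :=
  fun W _ _ K _ _ vbar κ₁ κ₂ γ₁ γ₂ _ h =>
    Summit.BirchSwinnertonDyer.BirchSwinnertonDyer.Theorems.TwoAdicBDPCharIdealPrincipal.exists_xGr₂_charIdeal_eq_span_two
      W K vbar κ₁ κ₂ γ₁ γ₂ h

/-- **stub S** (kernel algebra): Gauss rigidity over `𝒪_{ℂ₂}⟦T₁,T₂⟧` — KERNEL since tower-1 GEN 44 (p766427; master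
lemma `TwoAdicBDPGaussContent.forall_norm_coeff_le_of_forall_norm_coeff_mul_le`, the graded-lex ultrametric content
argument).  CAUTION retained: the slack MUST be a power of `2` (general slack is false: `C = T₁+2`, `G = T₁+4`). -/
theorem stub_gaussRigidity : GaussRigidity₂ :=
  fun C G h m h₁ h₂ h₃ =>
    Summit.BirchSwinnertonDyer.BirchSwinnertonDyer.Theorems.TwoAdicBDPGaussContent.span_le_span_of_two_pow_mul_eq_of_residue
      C G h m h₁ h₂ h₃

/-- **stub U** (research, XL; barrier-adjacent `EulerSystemBigImageAtSmallImage`, evaded by the RATIONAL currency):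
the two-variable Euler-system (Beilinson–Flach / BDP explicit reciprocity) inclusion at `2` on habitat (β), up to a
power of `2`, for EVERY admissible frame datum.  UNPRINTED at `p = 2` (LLZ/KLZ/BDP reciprocity laws are `p` odd; the
tree's ordinary theorem `span_le_charIdealXGr₂_map_of_goodOrd` is `p ≥ 5` + big image). -/
theorem stub_upperInclusionRat : TwoVariableUpperInclusionRatAtTwo := by
  sorry

/-- **stub R0G** (research, L; v6 — split out of v5's `stub_frameTorsion`, whose torsion part is now a theorem and whose
Katz half is PRINT): on habitat (β), for every embedding datum, adapted pair and admissible Katz datum `(Ω, δ, Ωp, LK)` at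
the split `2`, a two-variable Greenberg series `G = 𝓛_2^Gr(E/K) ∈ 𝒪_{ℂ₂}⟦T₁,T₂⟧` EXISTS relative to it
(`IsGreenbergLFunctionFree₂ … LK G`).  THE unprinted object at `2` (Castella–Hsieh Thm. 4.8 / CGS Thm. 2.4.1 / BSTW §9:
`p` odd; Kriz–Li 2019 at `2` is value-level; presearch g11: none at `2`). -/
theorem stub_greenbergFunctionFree : TwoVariableGreenbergObjectAtTwo := by
  sorry

/-! ### The v7 stubs replacing v6's `stub_lineFinite` (FINLINE₂ ∀-pairs): P2, P3, P4, P5 of seat 2's split-prime line — v8/v9: ALL FOUR DISCHARGED BY NAME (P4 modulo the PRINT stub: v8 `stub_gl1PrintFactsAtTwo` = Gr78 §4 ∧ OV16 1.2, v9 `stub_ovMuZeroPrintAtTwo` = OV16 1.2 alone, Gr78 §4 KERNEL) -/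

/-- **P2 SPLIT-PAIR-EXISTS — v8: a THEOREM, by name** (conv-1 GEN 39, p772855
`TwoAdicBDPSplitPrimePair.splitPrimePairExistsAt_two`; its conclusion `inertiaOutside K {v} ⊆ κ₂.kerSubgroup` IS `RamifiedOnlyIn κ₂ {v}`
unfolded): for `K` imaginary quadratic with `2 = v v̄` split there is an adapted top-generator pair `(κ₁, κ₂; γ₁, γ₂)` of `K̃_∞/K` whose
second line `κ₂` is ramified only at `v` (the `v`-ramified `ℤ₂`-quotient of `Gal(K(v^∞)/K)` is a primitive vector of
`Hom(Gal(K̃_∞/K), ℤ₂) ≅ ℤ₂²`, extended to a basis; CFT from the tree's `ZpExtensionSplitLineProofs`).  v7 stub; kept under its stub name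
as the record, sorry-free. -/
theorem stub_splitPrimePairExists : SplitPrimePairExistsAtTwo :=
  fun K _ _ => Summit.BirchSwinnertonDyer.BirchSwinnertonDyer.Theorems.TwoAdicBDPSplitPrimePair.splitPrimePairExistsAt_two K

/-- **P3 PAIR-TRANSPORT₂ — v8: a THEOREM, by name, UNCONDITIONAL** (tower-1 GEN 49, p775605
`TwoAdicBDPPairTransport.torsionResidueTransportAt_two`, no named fact: the `ℤ₂`-rank-2 input is the tree theorem
`ZpExtension.IsTopGeneratorPair.pairKer_eq_pairKer` for `[K:ℚ] ≤ 2`; algebraic core `smulFun₂_eq_smulFun₂_frameSubstRingHom`, p774915):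
`Module.IsTorsion Λ₂ X_Gr₂` and the residual non-vanishing of the characteristic generators are invariant under a change of adapted
top-generator pair at the same strict prime `v̄`.  v7 stub; kept under its stub name as the record, sorry-free. -/
theorem stub_torsionResidueTransport : TorsionResidueTransportAtTwo :=
  fun W _ K _ _ => Summit.BirchSwinnertonDyer.BirchSwinnertonDyer.Theorems.TwoAdicBDPPairTransport.torsionResidueTransportAt_two W K

/-- **Gr78 §4 IS A KERNEL THEOREM (v9), displayed BY NAME** — Greenberg 1978 §4, closing Remark
(`Greenberg1978.splitPrime_iwasawaModule_finite_torsion`: for `K` imaginary quadratic, `p = v v̄` split, the `ℤ_p`-line `κ` unramified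
outside `v`, ANY Pontryagin-dual datum `X ≅ X_∞ = Gal(M_∞/K_∞)` of `H¹_{nr outside v}(K_∞, ℚ_p/ℤ_p)` is finitely generated and TORSION
over `Λ`; all `p`) is PROVED in the tree with ZERO hypotheses by conv-1 GEN 41 (p777166
`TwoAdicBDPSplitPrimeTorsion.greenberg1978_splitPrime_iwasawaModule_finite_torsion_holds`; chain: idelic characters p776785 → line
restrictions finite p776845 ★ `finite_setOf_restrict_kerSubgroup` = `[M_v(K):K_∞] < ∞` → LinePush's
`finite_isTorsion_exists_charIdeal_of_finite_endInvariants_unr`).  This is v8's first PRINT conjunct DISCHARGED: the v8 stub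
`stub_gl1PrintFactsAtTwo : Gr78 §4 ∧ OV16 1.2` leaves the registry and narrows to `stub_ovMuZeroPrintAtTwo` below.  A formalised PRINTED
theorem, nothing beyond print.  [cite: Greenberg1978, §4 (closing Remark)] -/
theorem gr78_splitPrimeTorsion_holds :
    Literature.NumberTheory.IwasawaTheory.Greenberg1978.splitPrime_iwasawaModule_finite_torsion :=
  Summit.BirchSwinnertonDyer.BirchSwinnertonDyer.Theorems.TwoAdicBDPSplitPrimeTorsion.greenberg1978_splitPrime_iwasawaModule_finite_torsion_holds

/-- **stub PRINT-OV16₂ (v9; the ONE non-research sorry of this file): the ONE remaining GL(1) PRINT FACT at `p = 2` that P4 rests on,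
BY NAME** — Oukhaba–Viguié 2016 Thm 1.2 (`OukhabaViguie2016.thm12_splitPrime_muInvariant_eq_zero`: for `K` imaginary quadratic,
`p = v v̄` split, the `ℤ_p`-line unramified outside `v`, `μ(X_∞) = 0` — ALL `p` incl. `2`).  A typed Literature `def … : Prop` (t42 GEN 36;
audited AT 2 on the materialised pages, audit-2 sheet `D-AUDIT-hP4-OV16-Thm12-Gr78-sec4-CKL19-L51-splitPrime-GL1-line-at-2.md`
@f39f17631df63a03, PASS ×2); NOT restated here.  WHY A STUB and not a displayed binder of the composition (gate rule, v8 lesson): the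
skeleton audit admits only registered obligations as hypotheses of the crux-headed theorem — a Literature named-fact `def` rides as a
binder only when it is the signature of a LEDGER ITEM (de Shalit II.4.17 = `KatzSheetTwoVariablePrint` = stmt-24085 ✓; OV16 is not an
item yet — print-leaf items are W3-deferred, director (589)(i)); `skeleton.extra-hypothesis` otherwise.  A registered stub IS such an
obligation, honestly labelled PRINT.  Exit door: the planner files OV16 Thm 1.2 as a print-leaf item (then v10 = this stub → displayed
route binder, 3 stubs).  v8's other conjunct (Gr78 §4) is the kernel theorem `gr78_splitPrimeTorsion_holds` above.
[cite: OukhabaViguie2016MuInvariant, Thm 1.2 (arXiv:1311.3565 p0002 L6)] -/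
theorem stub_ovMuZeroPrintAtTwo :
    Literature.NumberTheory.IwasawaTheory.OukhabaViguie2016.thm12_splitPrime_muInvariant_eq_zero := by
  sorry

/-- **P4 GL1-FIN under the two print facts — v8: a THEOREM, by name** (t42 GEN 36 p774822 `…_of_printFacts hGr hOV hdec` with `hdec`
DISCHARGED by conv-1 GEN 40 p775363 `TwoAdicBDPSplitLineDecomposition.deShalit1987_propII19iii_holds`, packaged as p775402
`TwoAdicBDPEisensteinDevissage.trivialCharSplitLineFiniteAtTwo_of_twoPrintFacts`): GIVEN Gr78 §4 and OV16 1.2, for `K` imaginary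
quadratic, `2 = v v̄`, every `ℤ₂`-line `κ` ramified only at `v` and every finite `S₀`, `{t ∈ datumSelmerInfty κ (ℚ₂/ℤ₂)(𝟙) (bdpData v̄) S₀
| 2•t = 0}` is finite (`X_∞` f.g. over `ℤ₂` by torsion ∧ `μ = 0`, Washington §13.2; the places above `S₀` are finitely many on the line
because every `𝔮` is finitely decomposed in `K_∞^{(v)}` — the kernel `hdec`; each contributes pro-2 tame inertia `≅ ℤ₂`).
[cite: Greenberg1978, §4] [cite: OukhabaViguie2016MuInvariant, Thm 1.2] [cite: deShalit1987, II.1.9 (iii)] -/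
theorem trivialCharSplitLineFinite_of_twoPrintFacts
    (hGr : Literature.NumberTheory.IwasawaTheory.Greenberg1978.splitPrime_iwasawaModule_finite_torsion)
    (hOV : Literature.NumberTheory.IwasawaTheory.OukhabaViguie2016.thm12_splitPrime_muInvariant_eq_zero) :
    TrivialCharSplitLineFiniteAtTwo :=
  fun K _ _ =>
    Summit.BirchSwinnertonDyer.BirchSwinnertonDyer.Theorems.TwoAdicBDPEisensteinDevissage.trivialCharSplitLineFiniteAtTwo_of_twoPrintFacts
      hGr hOV K

/-- **P4 GL1-FIN under ONE print fact — v9: a THEOREM, by name** (conv-1 GEN 41 p777175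
`TwoAdicBDPEisensteinDevissage.trivialCharSplitLineFiniteAtTwo_of_muZero (hOV) (K)` = p775402's two-print-fact form with
`hGr := TwoAdicBDPSplitPrimeTorsion.greenberg1978_splitPrime_iwasawaModule_finite_torsion_holds` (p777166, kernel) and `hdec :=
TwoAdicBDPSplitLineDecomposition.deShalit1987_propII19iii_holds` (p775363, kernel)): GIVEN OV16 1.2 alone, for `K` imaginary quadratic,
`2 = v v̄`, every `ℤ₂`-line `κ` ramified only at `v` and every finite `S₀`, the `2`-torsion of the BDP-type Selmer set of the trivial
character over `K_∞^{(v)}` relaxed at `S₀` is finite.  [cite: OukhabaViguie2016MuInvariant, Thm 1.2] [cite: Greenberg1978, §4]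
[cite: deShalit1987, II.1.9 (iii)] -/
theorem trivialCharSplitLineFinite_of_muZero
    (hOV : Literature.NumberTheory.IwasawaTheory.OukhabaViguie2016.thm12_splitPrime_muInvariant_eq_zero) :
    TrivialCharSplitLineFiniteAtTwo :=
  fun K _ _ =>
    Summit.BirchSwinnertonDyer.BirchSwinnertonDyer.Theorems.TwoAdicBDPEisensteinDevissage.trivialCharSplitLineFiniteAtTwo_of_muZero
      hOV K

/-- **P4 from the registered PRINT stub** (v9): v7's `stub_trivialCharSplitLineFinite` is the sorry-free term
`fun K _ _ ↦ TwoAdicBDPEisensteinDevissage.trivialCharSplitLineFiniteAtTwo_of_muZero stub_ovMuZeroPrintAtTwo K` (conv-1 p777175, the pen's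
recommended (k1) spelling; = `trivialCharSplitLineFinite_of_muZero stub_ovMuZeroPrintAtTwo`); kept under its stub name as the record (no
`sorry` of its own — the only `sorry` on this road is the PRINT stub `stub_ovMuZeroPrintAtTwo`; Gr78 §4 and hdec are kernel). -/
theorem stub_trivialCharSplitLineFinite : TrivialCharSplitLineFiniteAtTwo :=
  fun K _ _ =>
    Summit.BirchSwinnertonDyer.BirchSwinnertonDyer.Theorems.TwoAdicBDPEisensteinDevissage.trivialCharSplitLineFiniteAtTwo_of_muZero
      stub_ovMuZeroPrintAtTwo K

/-- **P5 DEV — v8: a THEOREM, by name** (conv-1 GEN 40, p775208 `TwoAdicBDPEisensteinDevissage.eisensteinDevissageAt_two`; bricks p774914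
residual dévissage in INERTIA currency, p775028 Kummer step): for `W/ℚ` with `E[2]` reducible and any `K`, GL1-FIN ⟹ FIN-SPLIT along
`0 → 𝟙 → E[2] → 𝟙 → 0` (the `2`-torsion of the BDP-type Selmer set of `E[2^∞]` over every `v`-ramified line is bounded by two
trivial-character sets at `S₀ =` the bad places; `finite_of_finite_image_of_finite_inter_ker`).  Holds over EVERY `ℤ₂`-extension of `K`
(conv-1 NOTE §3); v7 stub; kept under its stub name as the record, sorry-free. -/
theorem stub_eisensteinDevissage : EisensteinDevissageAtTwo :=
  fun W _ K _ _ => Summit.BirchSwinnertonDyer.BirchSwinnertonDyer.Theorems.TwoAdicBDPEisensteinDevissage.eisensteinDevissageAt_two W K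

/-! ### §ACPIN (v5, seat 1's resplit, verbatim): pin the cofactor at a PRIME of the special fibre

Decls `FibrePinned`, `PrimePinning₂`, `TwoContent₂`, `GreenbergAcFibrePinningAt`, `AcFibrePinningAtTwo` and the node
`bdpSelmerLowerDivisibilityAtTwo_of_acPieces` are VERBATIM those of `Lines/anticyclotomic_fibre_pinning_two.lean`
(planner-cruxidea-stmt-BirchSwinnertonDyer-24728-1 GEN 3); the kernel proofs of PIN/CONTENT are imported by name from the lead's
`Theorems/TwoAdicConverseBDPSelmerLowerDivisibilityAtTwoPrimePinning.lean` (p768124). -/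

/-- **FibrePinned G C'** (seat 1, verbatim) — SOME prime `𝔓` of `𝔽̄₂⟦T₁,T₂⟧` with (N) `red G ∉ 𝔓` and (Λ) for every primitive part
`C₁` of `C'` (`C' = 2^a·C₁`, `red C₁ ≠ 0`): `red C₁ ∈ 𝔓 + (red G)`. -/
def FibrePinned (G C' : A₂) : Prop :=
  ∃ 𝔓 : Ideal Ω₂, 𝔓.IsPrime ∧ red₂ G ∉ 𝔓 ∧
    ∀ (a : ℕ) (C₁ : A₂), C' = (2 : A₂) ^ a * C₁ → red₂ C₁ ≠ 0 → red₂ C₁ ∈ 𝔓 ⊔ Ideal.span {red₂ G}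

/-- **PIN** (seat 1, verbatim): `2^m·G = 2^a·C₁·h`, `red C₁ ≠ 0`, prime `𝔓` with `red G ∉ 𝔓`, `red C₁ ∈ 𝔓 + (red G)` ⟹
`(2^a·C₁) ⊆ (G)`.  KERNEL (p768124). -/
def PrimePinning₂ : Prop :=
  ∀ (C₁ G h : A₂) (a m : ℕ) (𝔓 : Ideal Ω₂), 𝔓.IsPrime →
    (2 : A₂) ^ m * G = (2 : A₂) ^ a * C₁ * h → red₂ C₁ ≠ 0 → red₂ G ∉ 𝔓 →
    red₂ C₁ ∈ 𝔓 ⊔ Ideal.span {red₂ G} → Ideal.span {(2 : A₂) ^ a * C₁} ≤ Ideal.span {G}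

/-- **CONTENT** (seat 1, verbatim): every nonzero `C₀ ∈ ℤ₂⟦T₁,T₂⟧` reads as `2^a·C₁` with `red C₁ ≠ 0`.  KERNEL (p768124). -/
def TwoContent₂ : Prop :=
  ∀ (J : ℤ_[2] →+* PadicComplexInt 2) (C₀ : IwasawaAlgebra₂ 2), C₀ ≠ 0 →
    ∃ (a : ℕ) (C₁ : A₂), toUnr₂ 2 J C₀ = (2 : A₂) ^ a * C₁ ∧ red₂ C₁ ≠ 0

/-- **stub PIN** (kernel algebra) — by name from p768124 `TwoAdicBDPPrimePinning.span_le_span_of_prime_pin_two`. -/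
theorem stub_primePinning : PrimePinning₂ :=
  fun C₁ G h a m 𝔓 h𝔓 h₁ h₂ h₃ h₄ =>
    Summit.BirchSwinnertonDyer.BirchSwinnertonDyer.Theorems.TwoAdicBDPPrimePinning.span_le_span_of_prime_pin_two
      C₁ G h a m 𝔓 h𝔓 h₁ h₂ h₃ h₄

/-- **stub CONTENT** (kernel algebra) — by name from p768124 `TwoAdicBDPPrimePinning.exists_toUnr₂_eq_two_pow_mul_of_ne_zero`. -/
theorem stub_twoContent : TwoContent₂ :=
  fun J C₀ hC₀ =>
    Summit.BirchSwinnertonDyer.BirchSwinnertonDyer.Theorems.TwoAdicBDPPrimePinning.exists_toUnr₂_eq_two_pow_mul_of_ne_zero J C₀ hC₀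

/-- **ACPIN at `(E,K)`** (seat 1, verbatim) — for every admissible frame datum, every structure map `J` and every generator
`C₀` of `ch_{Λ_K}(X_Gr(E/K̃_∞))`: `FibrePinned G (J C₀)` — some prime `𝔓` of the special fibre (INTENDED: the residual
anticyclotomic line in the pair's coordinates) carries (N) `μ(G|_𝔓) = 0` and (Λ) `λ(G|_𝔓) ≤ λ(C₁|_𝔓)` for the primitive
part `C₁` of `J C₀`.  No algebraic `μ = 0`, no two-variable ideal equality. -/
def GreenbergAcFibrePinningAt (W : WeierstrassCurve ℚ) [W.IsElliptic] [W.IsGloballyMinimal]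
    (K : Type) [Field K] [NumberField K] : Prop :=
  ∀ [IsCMField K] (ι : PadicAlgCl 2 ≃+* ℂ) (v vbar : HeightOneSpectrum (𝓞 K)) (κ₁ κ₂ : ZpExtension K 2)
    (γ₁ γ₂ : absoluteGaloisGroup K) [Fact (ZpExtension.IsTopGeneratorPair κ₁ κ₂ γ₁ γ₂)]
    [NeZero (W.conductorNorm ℤ)] (f : CuspForm (Gamma0 (W.conductorNorm ℤ)) 2),
    ModularForms.IsNewformOf W f → ∀ [NeZero (NumberField.discr K).natAbs],
    ((2 : ℕ) : 𝓞 K) ∈ v.asIdeal → ((2 : ℕ) : 𝓞 K) ∈ vbar.asIdeal → vbar ≠ v →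
    (∀ (w : InfinitePlace K) (k : 𝓞 K), k ∈ v.asIdeal ↔ ‖ι.symm (w.embedding (k : K))‖ < 1) →
    ∀ (Ω δ : ℂ) (Ωp : (unrIntegers 2)ˣ) (LK G : A₂),
      Ω ≠ 0 → (δ ^ 2 = (NumberField.discr K : ℂ) ∨ δ ^ 2 = -(NumberField.discr K : ℂ)) →
      IsKatzMeasure₂ ι v vbar ∅ κ₁ κ₂ γ₁⁻¹ γ₂⁻¹ 1 Ω δ ((Ωp : unrIntegers 2) : ℂ_[2]) LK →
      IsGreenbergLFunctionFree₂ ι v vbar κ₁ κ₂ γ₁⁻¹ γ₂⁻¹ f (NumberField.discr K).natAbs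
        (NumberField.classNumber K) LK G →
      ∀ J : ℤ_[2] →+* PadicComplexInt 2,
        (∀ x : ℤ_[2], ((J x : PadicComplexInt 2) : ℂ_[2]) = ((x : ℚ_[2]) : ℂ_[2])) →
        ∀ C₀ : IwasawaAlgebra₂ 2,
          WeierstrassCurve.XGr₂.charIdeal (W.baseChange K) 2 κ₁ κ₂ vbar γ₁ γ₂ = Ideal.span {C₀} →
          FibrePinned G (toUnr₂ 2 J C₀)

/-- **ACPIN on the habitat (β)** (seat 1, verbatim). -/
def AcFibrePinningAtTwo : Prop :=
  ∀ (W : WeierstrassCurve ℚ) [W.IsElliptic] [W.IsGloballyMinimal],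
    ¬ W.HasCM → GoodOrd W 2 → ¬ W.HasIrreducibleModPGaloisRep 2 →
    ∀ (K : Type) [Field K] [NumberField K],
      (IsImaginaryQuadratic K ∧ SatisfiesHeegnerHypothesis (2 * W.conductorNorm ℤ) K) →
      GreenbergAcFibrePinningAt W K

/-- **stub ACPIN** (research, XL; HONEST HARDEST — leaves N_ac: `μ = 0` of `G` along the residual anticyclotomic line at `2`
(Hida/Hsieh/BCS `p` odd; INSTRUMENTABLE), Λ_ac: the one-line CM congruence at `2` (Kriz 2016 Thm. 3, hypothesis only `p ∤ N`;
constant `1/(4𝔤(ψ₂⁻¹))` to audit) + GL(1)/K main conjecture at `2` (Kezuka 2019 / Müller 2020) + GV bookkeeping at `2` —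
seat 2 g4's `residual_selmer_control_two` re-types Λ_ac in `λ`-currency under P1 PURITY₂ / P2 / P3): on habitat (β), for
every admissible frame datum, every `J`, every generator `C₀` of `ch(X_Gr)`, `FibrePinned G (toUnr₂ 2 J C₀)`. -/
theorem stub_acFibrePinning : AcFibrePinningAtTwo := by
  sorry

/-! ## §4 The discharges BY NAME (v6): COFGEN₂ (tower-1 GEN 46), TORSION and `μ₂ = 0` from FINLINE₂ (tower-1 GEN 47), the Katz half (lead's p767724) -/

/-- **COFGEN₂ is a THEOREM** at every datum (tower-1 GEN 46 p768155 `TwoAdicBDPCofiniteGeneration.moduleFinite_xGr₂_baseChange_two`,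
no hypothesis on `W / K / pair / v̄`). -/
theorem xGr₂Cofg_holds (W : WeierstrassCurve ℚ) [W.IsElliptic] [W.IsGloballyMinimal] (K : Type) [Field K] [NumberField K] :
    XGr₂CofgAt W K :=
  fun _ vbar κ₁ κ₂ γ₁ γ₂ _ _ _ _ =>
    Summit.BirchSwinnertonDyer.BirchSwinnertonDyer.Theorems.TwoAdicBDPCofiniteGeneration.moduleFinite_xGr₂_baseChange_two
      W K κ₁ κ₂ vbar γ₁ γ₂

/-- COFGEN₂ on the habitat: a theorem (no stub). -/
theorem twoVariableCofgAtTwo_holds : TwoVariableCofgAtTwo :=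
  fun W _ _ _ _ _ K _ _ _ => xGr₂Cofg_holds W K

/-- **R0T ⟸ R0F ∧ FINLINE₂ at a datum** (`K` imaginary quadratic): the torsion conjunct of the OBJECT half from ONE line, BY NAME
(`TwoAdicBDPTowerLineControl.xGr₂_baseChange_two_isTorsion_of_lineFinite`, tower-1 GEN 47 p769393; FD discharged inside by
`ZpExtension.not_decomp_le_kerSubgroup_of_isImaginaryQuadratic`, COFGEN₂ inside by GEN 46). -/
theorem greenbergFrameTorsionAt_of_frame_of_lineSelmerFinite (W : WeierstrassCurve ℚ) [W.IsElliptic] [W.IsGloballyMinimal]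
    (K : Type) [Field K] [NumberField K] (hK : IsImaginaryQuadratic K)
    (hF : GreenbergFrameAt W K) (hL : XGr₂LineSelmerFiniteAt W K) : GreenbergFrameTorsionAt W K := by
  intro _ ι v vbar κ₁ κ₂ γ₁ γ₂ _ _ f hf _ hv hvbar hne hι
  obtain ⟨Ω, δ, Ωp, LK, G, hΩ, hδ, hLK, hG⟩ := hF ι v vbar κ₁ κ₂ γ₁ γ₂ f hf hv hvbar hne hι
  exact ⟨Ω, δ, Ωp, LK, G, hΩ, hδ, hLK, hG,
    Summit.BirchSwinnertonDyer.BirchSwinnertonDyer.Theorems.TwoAdicBDPTowerLineControl.xGr₂_baseChange_two_isTorsion_of_lineFinite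
      W K hK κ₁ κ₂ vbar hvbar γ₁ γ₂ (hL v vbar κ₁ κ₂ γ₁ γ₂ hv hvbar hne)⟩

/-- **Rres ⟸ FINLINE₂ ∧ RresEq at a datum** (`K` imaginary quadratic): the `μ₂ = 0` clause `red(toUnr₂ J C) ≠ 0` from ONE line,
BY NAME (`TwoAdicBDPTowerLineControl.xGr₂_baseChange_two_map_residue_toUnr₂_ne_zero_of_lineFinite`, tower-1 GEN 47 p769393). -/
theorem greenbergResidualEqualityForallAt_of_lineSelmerFinite_of_spanEq (W : WeierstrassCurve ℚ) [W.IsElliptic]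
    [W.IsGloballyMinimal] (K : Type) [Field K] [NumberField K] (hK : IsImaginaryQuadratic K)
    (hL : XGr₂LineSelmerFiniteAt W K) (hE : GreenbergResidualSpanEqForallAt W K) :
    GreenbergResidualEqualityForallAt W K := by
  intro _ ι v vbar κ₁ κ₂ γ₁ γ₂ _ _ f hf _ hv hvbar hne hι Ω δ Ωp LK G hΩ hδ hLK hG J hJ C hC
  exact ⟨Summit.BirchSwinnertonDyer.BirchSwinnertonDyer.Theorems.TwoAdicBDPTowerLineControl.xGr₂_baseChange_two_map_residue_toUnr₂_ne_zero_of_lineFinite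
      W K hK κ₁ κ₂ vbar hvbar γ₁ γ₂ (hL v vbar κ₁ κ₂ γ₁ γ₂ hv hvbar hne) J hC,
    hE ι v vbar κ₁ κ₂ γ₁ γ₂ f hf hv hvbar hne hι Ω δ Ωp LK G hΩ hδ hLK hG J hJ C hC⟩

/-- **R0F ⟸ de Shalit II.4.17 ∧ R0G at a datum** (`K` imaginary quadratic), by name from the lead's p767724
(`TwoAdicBDPKatzFrame.exists_frame_two_of_katzSheet_of_forall_katz`). -/
theorem greenbergFrameAt_of_katzSheet_of_object (hdS : DeShalit1987.thmII417_exists_katzSheet)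
    (W : WeierstrassCurve ℚ) [W.IsElliptic] [W.IsGloballyMinimal] (K : Type) [Field K] [NumberField K]
    (hK : IsImaginaryQuadratic K) (hG : GreenbergObjectAt W K) : GreenbergFrameAt W K := by
  intro _ ι v vbar κ₁ κ₂ γ₁ γ₂ hpair _ f hf _ hv hvbar hne hι
  exact Summit.BirchSwinnertonDyer.BirchSwinnertonDyer.Theorems.TwoAdicBDPKatzFrame.exists_frame_two_of_katzSheet_of_forall_katz
    hdS W hK ι v vbar κ₁ κ₂ γ₁ γ₂ hpair.out f hv hvbar hne hι (hG ι v vbar κ₁ κ₂ γ₁ γ₂ f hf hv hvbar hne hι)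

/-- `PRINT{thmII417} → R0G → R0F` on the habitat (`IsImaginaryQuadratic K` read off the habitat clause). -/
theorem frameAtTwo_of_katzSheet_of_object (hdS : DeShalit1987.thmII417_exists_katzSheet) :
    TwoVariableGreenbergObjectAtTwo → TwoVariableFrameAtTwo :=
  fun hG W _ _ hCM hGO hβ K _ _ hK =>
    greenbergFrameAt_of_katzSheet_of_object hdS W K hK.1 (hG W hCM hGO hβ K hK)

/-- `R0F → FINLINE₂ → R0T` on the habitat (by name from tower-1 GEN 46/47). -/
theorem frameTorsion_of_frame_of_lineFinite :
    TwoVariableFrameAtTwo → TwoVariableLineSelmerFiniteAtTwo → TwoVariableFrameTorsionAtTwo :=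
  fun hF hL W _ _ hCM hGO hβ K _ _ hK =>
    greenbergFrameTorsionAt_of_frame_of_lineSelmerFinite W K hK.1 (hF W hCM hGO hβ K hK) (hL W hCM hGO hβ K hK)

/-- **`PRINT{thmII417} → R0G → FINLINE₂ → R0T` on the habitat** — v5's research stub `stub_frameTorsion` is this THEOREM
modulo the print and the two v6 stubs R0G, FINLINE₂. -/
theorem frameTorsion_of_katzSheet_of_object_of_lineFinite (hdS : DeShalit1987.thmII417_exists_katzSheet) :
    TwoVariableGreenbergObjectAtTwo → TwoVariableLineSelmerFiniteAtTwo → TwoVariableFrameTorsionAtTwo :=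
  fun hG hL => frameTorsion_of_frame_of_lineFinite (frameAtTwo_of_katzSheet_of_object hdS hG) hL

/-- `FINLINE₂ → RresEq → Rres` on the habitat (by name from tower-1 GEN 47). -/
theorem residualEqualityForall_of_lineFinite_of_spanEq :
    TwoVariableLineSelmerFiniteAtTwo → TwoVariableResidualSpanEqualityAtTwo → TwoVariableResidualEqualityForallAtTwo :=
  fun hL hE W _ _ hCM hGO hβ K _ _ hK =>
    greenbergResidualEqualityForallAt_of_lineSelmerFinite_of_spanEq W K hK.1 (hL W hCM hGO hβ K hK) (hE W hCM hGO hβ K hK)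

/-! ### §4-v7 The split-prime seam (seat 2 GEN 6, KERNEL, verbatim) and the torsion/residue consumers -/

/-- **Node seam (seat 2, verbatim).**  For `K` imaginary quadratic: finiteness on the v-ramified lines, existence of a split
adapted pair and pair transport give, at EVERY adapted pair, the torsion of `X_Gr((E_K)/K̃_∞)` and the residual non-vanishing of
its characteristic generators — through the tree doors of `TwoAdicBDPTowerLineControl` (tower-1 GEN 47 p769393). -/
theorem torsionResidueForall_of_splitLine (W : WeierstrassCurve ℚ) [W.IsElliptic] (K : Type) [Field K]
    [NumberField K] (hK : IsImaginaryQuadratic K) (hfin : SplitPrimeLineSelmerFiniteAt W K)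
    (hex : SplitPrimePairExistsAt K) (htr : TorsionResidueTransportAt W K) : TorsionResidueForallAt W K := by
  intro _ v vbar hv hvbar hne κ₁ κ₂ γ₁ γ₂ _
  obtain ⟨κ₁', κ₂', γ₁', γ₂', hpair', hram⟩ := hex hK v vbar hv hvbar hne
  haveI : Fact (ZpExtension.IsTopGeneratorPair κ₁' κ₂' γ₁' γ₂') := ⟨hpair'⟩
  have hline : LineSelmerTwoTorsionFinite W K κ₂' vbar := hfin hK v vbar κ₂' hv hvbar hne hram
  obtain ⟨htor, hres⟩ := htr hK vbar hvbar κ₁ κ₂ κ₁' κ₂' γ₁ γ₂ γ₁' γ₂'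
  refine ⟨htor (xGr₂_baseChange_two_isTorsion_of_lineFinite W K hK κ₁' κ₂' vbar hvbar γ₁' γ₂' hline), ?_⟩
  exact hres fun J C₀ hC ↦
    xGr₂_baseChange_two_map_residue_toUnr₂_ne_zero_of_lineFinite W K hK κ₁' κ₂' vbar hvbar γ₁' γ₂' hline J hC

/-- Sub-node seam (seat 2, verbatim; modus ponens — the content is in DEV and GL1-FIN). -/
theorem splitPrimeLineSelmerFinite_of_devissage (W : WeierstrassCurve ℚ) [W.IsElliptic] (K : Type) [Field K]
    [NumberField K] (hdev : EisensteinDevissageAt W K) (hred : ¬ W.HasIrreducibleModPGaloisRep 2)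
    (hgl1 : TrivialCharSplitLineFiniteAt K) : SplitPrimeLineSelmerFiniteAt W K :=
  hdev hred hgl1

/-- **First brick of DEV (seat 2, verbatim; kernel): the counting dévissage.**  If an additive map `f` has finite image on a
subgroup `S` and `S` meets `ker f` in a finite set, then `S` is finite (`|S| ≤ |f(S)|·|S ∩ ker f|`). -/
theorem finite_of_finite_image_of_finite_inter_ker {B C : Type*} [AddCommGroup B] [AddCommGroup C] (f : B →+ C)
    (S : AddSubgroup B) (himg : (f '' (S : Set B)).Finite) (hker : ((S : Set B) ∩ {b | f b = 0}).Finite) :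
    (S : Set B).Finite := by
  have hsec : ∀ c ∈ f '' (S : Set B), ∃ s ∈ (S : Set B), f s = c := fun c hc ↦ by
    obtain ⟨s, hs, rfl⟩ := hc
    exact ⟨s, hs, rfl⟩
  choose! g hgS hgf using hsec
  have hsub : (S : Set B) ⊆
      (fun q : C × B ↦ g q.1 + q.2) '' ((f '' (S : Set B)) ×ˢ ((S : Set B) ∩ {b | f b = 0})) := by
    intro s hs
    have hfs : f s ∈ f '' (S : Set B) := ⟨s, hs, rfl⟩
    refine ⟨(f s, s - g (f s)), ⟨hfs, ?_, ?_⟩, ?_⟩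
    · exact S.sub_mem hs (hgS (f s) hfs)
    · show f (s - g (f s)) = 0
      rw [map_sub, hgf (f s) hfs, sub_self]
    · show g (f s) + (s - g (f s)) = s
      abel
  exact ((himg.prod hker).image _).subset hsub

/-- **v6's FINLINE₂ (∀ pairs) is STRONGER than what the node consumes**: it gives torsion ∧ residue at every pair directly through
the doors (no transport, no split line).  Sorry-free; FINLINE₂ is no longer a stub. -/
theorem torsionResidueForallAt_of_lineSelmerFinite (W : WeierstrassCurve ℚ) [W.IsElliptic] [W.IsGloballyMinimal]
    (K : Type) [Field K] [NumberField K] (hL : XGr₂LineSelmerFiniteAt W K) : TorsionResidueForallAt W K := by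
  intro hK v vbar hv hvbar hne κ₁ κ₂ γ₁ γ₂ _
  exact ⟨xGr₂_baseChange_two_isTorsion_of_lineFinite W K hK κ₁ κ₂ vbar hvbar γ₁ γ₂ (hL v vbar κ₁ κ₂ γ₁ γ₂ hv hvbar hne),
    fun J C₀ hC => xGr₂_baseChange_two_map_residue_toUnr₂_ne_zero_of_lineFinite W K hK κ₁ κ₂ vbar hvbar γ₁ γ₂
      (hL v vbar κ₁ κ₂ γ₁ γ₂ hv hvbar hne) J hC⟩

/-- **R0T ⟸ R0F ∧ (TORSION ∧ RESIDUE) at a datum** (`K` imaginary quadratic) — the v7 consumer of the object half. -/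
theorem greenbergFrameTorsionAt_of_frame_of_torsionResidue (W : WeierstrassCurve ℚ) [W.IsElliptic] [W.IsGloballyMinimal]
    (K : Type) [Field K] [NumberField K] (hK : IsImaginaryQuadratic K)
    (hF : GreenbergFrameAt W K) (hT : TorsionResidueForallAt W K) : GreenbergFrameTorsionAt W K := by
  intro _ ι v vbar κ₁ κ₂ γ₁ γ₂ _ _ f hf _ hv hvbar hne hι
  obtain ⟨Ω, δ, Ωp, LK, G, hΩ, hδ, hLK, hG⟩ := hF ι v vbar κ₁ κ₂ γ₁ γ₂ f hf hv hvbar hne hι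
  exact ⟨Ω, δ, Ωp, LK, G, hΩ, hδ, hLK, hG, (hT hK v vbar hv hvbar hne κ₁ κ₂ γ₁ γ₂).1⟩

/-- **Rres ⟸ (TORSION ∧ RESIDUE) ∧ RresEq at a datum** (`K` imaginary quadratic) — the v7 consumer on the RresEq road
(`ResidueNonvanishing J C` IS `red₂ (toUnr₂ 2 J C) ≠ 0`). -/
theorem greenbergResidualEqualityForallAt_of_torsionResidue_of_spanEq (W : WeierstrassCurve ℚ) [W.IsElliptic]
    [W.IsGloballyMinimal] (K : Type) [Field K] [NumberField K] (hK : IsImaginaryQuadratic K)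
    (hT : TorsionResidueForallAt W K) (hE : GreenbergResidualSpanEqForallAt W K) :
    GreenbergResidualEqualityForallAt W K := by
  intro _ ι v vbar κ₁ κ₂ γ₁ γ₂ _ _ f hf _ hv hvbar hne hι Ω δ Ωp LK G hΩ hδ hLK hG J hJ C hC
  exact ⟨(hT hK v vbar hv hvbar hne κ₁ κ₂ γ₁ γ₂).2 J C hC,
    hE ι v vbar κ₁ κ₂ γ₁ γ₂ f hf hv hvbar hne hι Ω δ Ωp LK G hΩ hδ hLK hG J hJ C hC⟩

/-- **`P2 → P3 → P4 → P5 → (TORSION ∧ RESIDUE)` on the habitat** — seat 2's seam fed by the four v7 stubs' shapes; the habitat supplies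
`IsImaginaryQuadratic K` (`hK.1`) and `¬ Irr E[2]` (`hβ`). -/
theorem torsionResidue_of_splitPieces :
    SplitPrimePairExistsAtTwo → TorsionResidueTransportAtTwo → TrivialCharSplitLineFiniteAtTwo → EisensteinDevissageAtTwo →
      TwoVariableTorsionResidueAtTwo :=
  fun hex htr hgl1 hdev W _ _ _ _ hβ K _ _ hK =>
    torsionResidueForall_of_splitLine W K hK.1
      (splitPrimeLineSelmerFinite_of_devissage W K (hdev W K) hβ (hgl1 K)) (hex K) (htr W K)

/-- `FINLINE₂ → (TORSION ∧ RESIDUE)` on the habitat (v6's stub as a stronger input). -/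
theorem torsionResidue_of_lineFinite : TwoVariableLineSelmerFiniteAtTwo → TwoVariableTorsionResidueAtTwo :=
  fun hL W _ _ hCM hGO hβ K _ _ hK => torsionResidueForallAt_of_lineSelmerFinite W K (hL W hCM hGO hβ K hK)

/-- `R0F → (TORSION ∧ RESIDUE) → R0T` on the habitat. -/
theorem frameTorsion_of_frame_of_torsionResidue :
    TwoVariableFrameAtTwo → TwoVariableTorsionResidueAtTwo → TwoVariableFrameTorsionAtTwo :=
  fun hF hT W _ _ hCM hGO hβ K _ _ hK =>
    greenbergFrameTorsionAt_of_frame_of_torsionResidue W K hK.1 (hF W hCM hGO hβ K hK) (hT W hCM hGO hβ K hK)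

/-- **`PRINT{thmII417} → R0G → (TORSION ∧ RESIDUE) → R0T` on the habitat** — v7's form of v5's `stub_frameTorsion`. -/
theorem frameTorsion_of_katzSheet_of_object_of_torsionResidue (hdS : DeShalit1987.thmII417_exists_katzSheet) :
    TwoVariableGreenbergObjectAtTwo → TwoVariableTorsionResidueAtTwo → TwoVariableFrameTorsionAtTwo :=
  fun hG hT => frameTorsion_of_frame_of_torsionResidue (frameAtTwo_of_katzSheet_of_object hdS hG) hT

/-- `(TORSION ∧ RESIDUE) → RresEq → Rres` on the habitat. -/
theorem residualEqualityForall_of_torsionResidue_of_spanEq :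
    TwoVariableTorsionResidueAtTwo → TwoVariableResidualSpanEqualityAtTwo → TwoVariableResidualEqualityForallAtTwo :=
  fun hT hE W _ _ hCM hGO hβ K _ _ hK =>
    greenbergResidualEqualityForallAt_of_torsionResidue_of_spanEq W K hK.1 (hT W hCM hGO hβ K hK) (hE W hCM hGO hβ K hK)

/-! ## §5 The nodes (sorry-free implications concluding `O2Goal`) and the composition (concludes the crux BY NAME) -/

/-- **THE ACPIN NODE (v5, seat 1 verbatim)** `O2 ⟸ P0 ∧ PIN ∧ CONTENT ∧ U ∧ R0T ∧ ACPIN`.  Given the frame from R0T, a generator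
`C₀` from P0, the slack `2^m G ∈ (J C₀)` from U, the content decomposition `J C₀ = 2^a C₁` from CONTENT and the prime `𝔓` from
ACPIN, PIN pins the cofactor: `(J C₀) ⊆ (G)`. -/
theorem bdpSelmerLowerDivisibilityAtTwo_of_acPieces :
    XGr₂CharIdealPrincipalAtTwo → PrimePinning₂ → TwoContent₂ → TwoVariableUpperInclusionRatAtTwo →
      TwoVariableFrameTorsionAtTwo → AcFibrePinningAtTwo → O2Goal := by
  intro hP hPin hCt hU h0 hA W _ _ hCM hGO hβ K _ _ hK _ ι v vbar κ₁ κ₂ γ₁ γ₂ _ _ f hf _ hv hvbar hne hι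
  obtain ⟨Ω, δ, Ωp, LK, G, hΩ, hδ, hLK, hG, htor⟩ :=
    h0 W hCM hGO hβ K hK ι v vbar κ₁ κ₂ γ₁ γ₂ f hf hv hvbar hne hι
  refine ⟨Ω, δ, Ωp, LK, G, hΩ, hδ, hLK, hG, htor, fun J hJ => ?_⟩
  obtain ⟨C₀, hC₀⟩ := hP W K vbar κ₁ κ₂ γ₁ γ₂ htor
  obtain ⟨m, hm⟩ := hU W hCM hGO hβ K hK ι v vbar κ₁ κ₂ γ₁ γ₂ f hf hv hvbar hne hι Ω δ Ωp LK G hΩ hδ hLK hG J hJ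
  obtain ⟨𝔓, h𝔓, hN, hΛ⟩ :=
    hA W hCM hGO hβ K hK ι v vbar κ₁ κ₂ γ₁ γ₂ f hf hv hvbar hne hι Ω δ Ωp LK G hΩ hδ hLK hG J hJ C₀ hC₀
  rw [hC₀, Ideal.map_span, Set.image_singleton] at hm ⊢
  obtain ⟨h, hh⟩ := Ideal.mem_span_singleton'.mp (hm (Ideal.mem_span_singleton_self _))
  by_cases hC00 : C₀ = 0
  · rw [hC00, map_zero, Ideal.span_singleton_eq_bot.mpr rfl]
    exact bot_le
  · obtain ⟨a, C₁, haC₁, hC₁⟩ := hCt J C₀ hC00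
    rw [haC₁] at hh ⊢
    exact hPin C₁ G h a m 𝔓 h𝔓 (by rw [← hh]; ring) hC₁ hN (hΛ a C₁ haC₁ hC₁)

/-- **The node over the pair-independent input: `O2 ⟸ PRINT{de Shalit II.4.17} ∧ U ∧ R0G ∧ (TORSION ∧ RESIDUE) ∧ ACPIN`, sorry-free**
(P0, PIN, CONTENT kernel by name). -/
theorem bdpSelmerLowerDivisibilityAtTwo_of_katzSheet_of_torsionResidue_of_acPin (hdS : DeShalit1987.thmII417_exists_katzSheet) :
    TwoVariableUpperInclusionRatAtTwo → TwoVariableGreenbergObjectAtTwo → TwoVariableTorsionResidueAtTwo →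
      AcFibrePinningAtTwo → O2Goal :=
  fun hU hG hT hA => bdpSelmerLowerDivisibilityAtTwo_of_acPieces stub_charIdealPrincipal stub_primePinning stub_twoContent hU
    (frameTorsion_of_katzSheet_of_object_of_torsionResidue hdS hG hT) hA

/-- ★ **THE NODE v7: `O2 ⟸ PRINT{de Shalit II.4.17} ∧ U ∧ R0G ∧ P2 ∧ P3 ∧ P4 ∧ P5 ∧ ACPIN`, sorry-free** (P0, PIN, CONTENT, COFGEN₂,
the tower→line doors, FD and seat 2's split-prime seam KERNEL by name).  Research/kernel residue of the line = {U, R0G, ACPIN} ∪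
{P2 (CFT), P3 (pair transport), P4 (GL(1) print at 2), P5 (Eisenstein dévissage)}; ONE printed named fact displayed. -/
theorem bdpSelmerLowerDivisibilityAtTwo_of_katzSheet_of_splitLine_of_acPin (hdS : DeShalit1987.thmII417_exists_katzSheet) :
    TwoVariableUpperInclusionRatAtTwo → TwoVariableGreenbergObjectAtTwo → SplitPrimePairExistsAtTwo →
      TorsionResidueTransportAtTwo → TrivialCharSplitLineFiniteAtTwo → EisensteinDevissageAtTwo →
        AcFibrePinningAtTwo → O2Goal :=
  fun hU hG hex htr hgl1 hdev hA => bdpSelmerLowerDivisibilityAtTwo_of_katzSheet_of_torsionResidue_of_acPin hdS hU hG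
    (torsionResidue_of_splitPieces hex htr hgl1 hdev) hA

/-- **THE NODE v6 (kept; FINLINE₂ now a STRONGER sorry-free input, not a stub): `O2 ⟸ PRINT ∧ U ∧ R0G ∧ FINLINE₂ ∧ ACPIN`.** -/
theorem bdpSelmerLowerDivisibilityAtTwo_of_katzSheet_of_lineFinite_of_acPin (hdS : DeShalit1987.thmII417_exists_katzSheet) :
    TwoVariableUpperInclusionRatAtTwo → TwoVariableGreenbergObjectAtTwo → TwoVariableLineSelmerFiniteAtTwo →
      AcFibrePinningAtTwo → O2Goal :=
  fun hU hG hL hA => bdpSelmerLowerDivisibilityAtTwo_of_katzSheet_of_torsionResidue_of_acPin hdS hU hG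
    (torsionResidue_of_lineFinite hL) hA

/-- **(TORSION ∧ RESIDUE) on the habitat GIVEN the two GL(1) print facts — v8, sorry-free**: seat 2's seam fed with the kernel theorems
P2 (p772855), P3 (p775605), P5 (p775208) and P4 under {Gr78 §4, OV16 1.2} (p775402).  [cite: Greenberg1978, §4]
[cite: OukhabaViguie2016MuInvariant, Thm 1.2] -/
theorem torsionResidue_of_twoPrintFacts
    (hGr : Literature.NumberTheory.IwasawaTheory.Greenberg1978.splitPrime_iwasawaModule_finite_torsion)
    (hOV : Literature.NumberTheory.IwasawaTheory.OukhabaViguie2016.thm12_splitPrime_muInvariant_eq_zero) :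
    TwoVariableTorsionResidueAtTwo :=
  torsionResidue_of_splitPieces stub_splitPrimePairExists stub_torsionResidueTransport
    (trivialCharSplitLineFinite_of_twoPrintFacts hGr hOV) stub_eisensteinDevissage

/-- ★ **THE NODE v8: `O2 ⟸ PRINT{de Shalit II.4.17; Greenberg 1978 §4; Oukhaba–Viguié 2016 Thm 1.2} ∧ U ∧ R0G ∧ ACPIN`, sorry-free** —
the v7 node `…_of_katzSheet_of_splitLine_of_acPin` fed with the four by-name discharges (P2 conv-1 p772855, P3 tower-1 p775605, P4 mod
print t42/conv-1 p775402, P5 conv-1 p775208); the THREE print facts are DISPLAYED binders, the THREE research stubs U, R0G, ACPIN are the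
antecedents; P0, PIN, CONTENT, COFGEN₂, the tower→line doors, FD, hdec and seat 2's split-prime seam are KERNEL by name.  This is the
count of record of the line after v8.  [cite: deShalit1987, II.4.17] [cite: Greenberg1978, §4] [cite: OukhabaViguie2016MuInvariant, Thm 1.2] -/
theorem bdpSelmerLowerDivisibilityAtTwo_of_katzSheet_of_printFacts_of_acPin (hdS : DeShalit1987.thmII417_exists_katzSheet)
    (hGr : Literature.NumberTheory.IwasawaTheory.Greenberg1978.splitPrime_iwasawaModule_finite_torsion)
    (hOV : Literature.NumberTheory.IwasawaTheory.OukhabaViguie2016.thm12_splitPrime_muInvariant_eq_zero) :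
    TwoVariableUpperInclusionRatAtTwo → TwoVariableGreenbergObjectAtTwo → AcFibrePinningAtTwo → O2Goal :=
  fun hU hG hA => bdpSelmerLowerDivisibilityAtTwo_of_katzSheet_of_splitLine_of_acPin hdS hU hG stub_splitPrimePairExists
    stub_torsionResidueTransport (trivialCharSplitLineFinite_of_twoPrintFacts hGr hOV) stub_eisensteinDevissage hA

/-- **(TORSION ∧ RESIDUE) on the habitat GIVEN ONE GL(1) print fact — v9, sorry-free**: v8's `torsionResidue_of_twoPrintFacts` with
`hGr := gr78_splitPrimeTorsion_holds` (conv-1 GEN 41 p777166, kernel); equivalently seat 2's seam fed with P2 (p772855), P3 (p775605),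
P5 (p775208) and P4 under {OV16 1.2} (p777175).  [cite: OukhabaViguie2016MuInvariant, Thm 1.2] [cite: Greenberg1978, §4] -/
theorem torsionResidue_of_muZero
    (hOV : Literature.NumberTheory.IwasawaTheory.OukhabaViguie2016.thm12_splitPrime_muInvariant_eq_zero) :
    TwoVariableTorsionResidueAtTwo :=
  torsionResidue_of_twoPrintFacts gr78_splitPrimeTorsion_holds hOV

/-- ★ **THE NODE v9: `O2 ⟸ PRINT{de Shalit II.4.17; Oukhaba–Viguié 2016 Thm 1.2} ∧ U ∧ R0G ∧ ACPIN`, sorry-free, ONE print binder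
fewer than v8** — the v8 node `…_of_katzSheet_of_printFacts_of_acPin` with `hGr := gr78_splitPrimeTorsion_holds` (Greenberg 1978 §4,
KERNEL since conv-1 GEN 41 p777166); the TWO remaining print facts are DISPLAYED binders (de Shalit II.4.17 = ledger item stmt-24085;
OV16 1.2 = the registered PRINT stub `stub_ovMuZeroPrintAtTwo` in the composition), the THREE research stubs U, R0G, ACPIN are the
antecedents; P0, PIN, CONTENT, COFGEN₂, the tower→line doors, FD, P2, P3, P5, hdec, hGr and seat 2's split-prime seam are KERNEL by
name.  This is the count of record of the line after v9.  [cite: deShalit1987, II.4.17] [cite: OukhabaViguie2016MuInvariant, Thm 1.2]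
[cite: Greenberg1978, §4] -/
theorem bdpSelmerLowerDivisibilityAtTwo_of_katzSheet_of_ovPrint_of_acPin (hdS : DeShalit1987.thmII417_exists_katzSheet)
    (hOV : Literature.NumberTheory.IwasawaTheory.OukhabaViguie2016.thm12_splitPrime_muInvariant_eq_zero) :
    TwoVariableUpperInclusionRatAtTwo → TwoVariableGreenbergObjectAtTwo → AcFibrePinningAtTwo → O2Goal :=
  bdpSelmerLowerDivisibilityAtTwo_of_katzSheet_of_printFacts_of_acPin hdS gr78_splitPrimeTorsion_holds hOV

/-- **(TORSION ∧ RESIDUE) from the registered stubs** — v9: P2, P3, P5, hGr are theorems; the only `sorry` on this road is the PRINT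
stub `stub_ovMuZeroPrintAtTwo` (inside `stub_trivialCharSplitLineFinite`); none here. -/
theorem torsionResidue_of_registered : TwoVariableTorsionResidueAtTwo :=
  torsionResidue_of_splitPieces stub_splitPrimePairExists stub_torsionResidueTransport stub_trivialCharSplitLineFinite
    stub_eisensteinDevissage

/-- **v5's R0T as a theorem modulo the registered stubs {R0G, PRINT-OV16₂} and the print leaf** (`KatzSheetTwoVariablePrint` :=
`DeShalit1987.thmII417_exists_katzSheet`, ledger item stmt-BirchSwinnertonDyer-24085 of route `PrintCf2RubinValueTwo`). -/
theorem frameTorsion_of_registered (hKatz : Theses.PrintCf2RubinValueTwo.KatzSheetTwoVariablePrint) :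
    TwoVariableFrameTorsionAtTwo :=
  frameTorsion_of_katzSheet_of_object_of_torsionResidue hKatz stub_greenbergFunctionFree torsionResidue_of_registered

/-- **THE SKELETON'S COMPOSITION (v9; text unchanged since v7)** — `O2` BY NAME from `stub_charIdealPrincipal` (P0, kernel),
`stub_primePinning` (PIN, kernel), `stub_twoContent` (CONTENT, kernel), `stub_splitPrimePairExists` (P2, kernel since v8),
`stub_torsionResidueTransport` (P3, kernel since v8), `stub_eisensteinDevissage` (P5, kernel since v8), `stub_trivialCharSplitLineFinite`
(P4, by name over the PRINT stub; Gr78 §4 kernel since v9) and the FOUR REGISTERED STUBS that still carry a `sorry`: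
`stub_upperInclusionRat` (U), `stub_greenbergFunctionFree` (R0G), `stub_acFibrePinning` (ACPIN), `stub_ovMuZeroPrintAtTwo` (PRINT:
OV16 1.2) — GIVEN the print leaf `KatzSheetTwoVariablePrint` (= `DeShalit1987.thmII417_exists_katzSheet`, de Shalit 1987 II.4.17; a
registered obligation of the ledger, stmt-BirchSwinnertonDyer-24085 — not a sorry of this file).  No sorry of its own. -/
theorem BDPSelmerLowerDivisibilityAtTwo_of (hKatz : Theses.PrintCf2RubinValueTwo.KatzSheetTwoVariablePrint) :
    BDPSelmerLowerDivisibilityAtTwo :=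
  bdpSelmerLowerDivisibilityAtTwo_of_acPieces stub_charIdealPrincipal stub_primePinning stub_twoContent stub_upperInclusionRat
    (frameTorsion_of_registered hKatz) stub_acFibrePinning

/-! ### The RresEq road (v4.1 leaf, now over TORSION ∧ RESIDUE) and the derived pieces — all conclude `O2Goal` -/

/-- The split at a datum: R0T ∧ Rres ⇒ R (logic only; seat 2's v2 annex). -/
theorem greenbergResidualEqualityAt_of_frame_of_forall (W : WeierstrassCurve ℚ) [W.IsElliptic] [W.IsGloballyMinimal]
    (K : Type) [Field K] [NumberField K]
    (h0 : GreenbergFrameTorsionAt W K) (hres : GreenbergResidualEqualityForallAt W K) :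
    GreenbergResidualEqualityAt W K := by
  intro _ ι v vbar κ₁ κ₂ γ₁ γ₂ _ _ f hf _ hv hvbar hne hι
  obtain ⟨Ω, δ, Ωp, LK, G, hΩ, hδ, hLK, hG, htor⟩ := h0 ι v vbar κ₁ κ₂ γ₁ γ₂ f hf hv hvbar hne hι
  exact ⟨Ω, δ, Ωp, LK, G, hΩ, hδ, hLK, hG, htor, fun J hJ C hC =>
    hres ι v vbar κ₁ κ₂ γ₁ γ₂ f hf hv hvbar hne hι Ω δ Ωp LK G hΩ hδ hLK hG J hJ C hC⟩

/-- `R0T → Rres → R` on the habitat, sorry-free (logic only). -/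
theorem residualEquality_of_split :
    TwoVariableFrameTorsionAtTwo → TwoVariableResidualEqualityForallAtTwo → TwoVariableResidualEqualityAtTwo := by
  intro h0 hres W _ _ hCM hGO hβ K _ _ hK
  exact greenbergResidualEqualityAt_of_frame_of_forall W K (h0 W hCM hGO hβ K hK) (hres W hCM hGO hβ K hK)

/-- The seam as a SORRY-FREE implication: `O2 ⟸ P0 ∧ S ∧ U ∧ R` (logic + `Ideal` algebra over the tree's definitions). -/
theorem bdpSelmerLowerDivisibilityAtTwo_of_pieces :
    XGr₂CharIdealPrincipalAtTwo → GaussRigidity₂ → TwoVariableUpperInclusionRatAtTwo →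
      TwoVariableResidualEqualityAtTwo → O2Goal := by
  intro hP hS hU hR W _ _ hCM hGO hβ K _ _ hK _ ι v vbar κ₁ κ₂ γ₁ γ₂ _ _ f hf _ hv hvbar hne hι
  obtain ⟨Ω, δ, Ωp, LK, G, hΩ, hδ, hLK, hG, htor, hres⟩ :=
    hR W hCM hGO hβ K hK ι v vbar κ₁ κ₂ γ₁ γ₂ f hf hv hvbar hne hι
  refine ⟨Ω, δ, Ωp, LK, G, hΩ, hδ, hLK, hG, htor, fun J hJ => ?_⟩
  obtain ⟨C, hC⟩ := hP W K vbar κ₁ κ₂ γ₁ γ₂ htor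
  obtain ⟨m, hm⟩ := hU W hCM hGO hβ K hK ι v vbar κ₁ κ₂ γ₁ γ₂ f hf hv hvbar hne hι Ω δ Ωp LK G hΩ hδ hLK hG J hJ
  obtain ⟨hC0, hspan⟩ := hres J hJ C hC
  rw [hC, Ideal.map_span, Set.image_singleton] at hm ⊢
  obtain ⟨h, hh⟩ := Ideal.mem_span_singleton'.mp (hm (Ideal.mem_span_singleton_self _))
  exact hS (toUnr₂ 2 J C) G h m (by rw [← hh, mul_comm]) hC0 hspan

/-- The node with R split: `O2 ⟸ P0 ∧ S ∧ U ∧ R0T ∧ Rres`, sorry-free. -/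
theorem bdpSelmerLowerDivisibilityAtTwo_of_split_pieces :
    XGr₂CharIdealPrincipalAtTwo → GaussRigidity₂ → TwoVariableUpperInclusionRatAtTwo →
      TwoVariableFrameTorsionAtTwo → TwoVariableResidualEqualityForallAtTwo → O2Goal :=
  fun hP hS hU h0 hres => bdpSelmerLowerDivisibilityAtTwo_of_pieces hP hS hU (residualEquality_of_split h0 hres)

/-- ★ **THE TWIN NODE (RresEq leaf): `O2 ⟸ PRINT{de Shalit II.4.17} ∧ U ∧ R0G ∧ (TORSION ∧ RESIDUE) ∧ RresEq`, sorry-free** — here the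
torsion/residue input is used TWICE: for the torsion conjunct AND for the `μ₂ = 0` clause. -/
theorem bdpSelmerLowerDivisibilityAtTwo_of_katzSheet_of_torsionResidue_of_spanEq (hdS : DeShalit1987.thmII417_exists_katzSheet) :
    TwoVariableUpperInclusionRatAtTwo → TwoVariableGreenbergObjectAtTwo → TwoVariableTorsionResidueAtTwo →
      TwoVariableResidualSpanEqualityAtTwo → O2Goal :=
  fun hU hG hT hE => bdpSelmerLowerDivisibilityAtTwo_of_split_pieces stub_charIdealPrincipal stub_gaussRigidity hU
    (frameTorsion_of_katzSheet_of_object_of_torsionResidue hdS hG hT) (residualEqualityForall_of_torsionResidue_of_spanEq hT hE)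

/-- The twin node over v6's FINLINE₂ (stronger input): `O2 ⟸ PRINT ∧ U ∧ R0G ∧ FINLINE₂ ∧ RresEq`, sorry-free. -/
theorem bdpSelmerLowerDivisibilityAtTwo_of_katzSheet_of_lineFinite_of_spanEq (hdS : DeShalit1987.thmII417_exists_katzSheet) :
    TwoVariableUpperInclusionRatAtTwo → TwoVariableGreenbergObjectAtTwo → TwoVariableLineSelmerFiniteAtTwo →
      TwoVariableResidualSpanEqualityAtTwo → O2Goal :=
  fun hU hG hL hE => bdpSelmerLowerDivisibilityAtTwo_of_katzSheet_of_torsionResidue_of_spanEq hdS hU hG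
    (torsionResidue_of_lineFinite hL) hE

/-- The twin node v7 (RresEq leaf over the split-prime pieces): `O2 ⟸ PRINT ∧ U ∧ R0G ∧ P2 ∧ P3 ∧ P4 ∧ P5 ∧ RresEq`, sorry-free. -/
theorem bdpSelmerLowerDivisibilityAtTwo_of_katzSheet_of_splitLine_of_spanEq (hdS : DeShalit1987.thmII417_exists_katzSheet) :
    TwoVariableUpperInclusionRatAtTwo → TwoVariableGreenbergObjectAtTwo → SplitPrimePairExistsAtTwo →
      TorsionResidueTransportAtTwo → TrivialCharSplitLineFiniteAtTwo → EisensteinDevissageAtTwo →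
        TwoVariableResidualSpanEqualityAtTwo → O2Goal :=
  fun hU hG hex htr hgl1 hdev hE => bdpSelmerLowerDivisibilityAtTwo_of_katzSheet_of_torsionResidue_of_spanEq hdS hU hG
    (torsionResidue_of_splitPieces hex htr hgl1 hdev) hE

/-- **Nothing is lost: Rres ⇒ ACPIN at a datum** (seat 1's `fibrePinned_of_residualEquality` at `𝔓 = ⊥`, recomposed on the frame). -/
theorem greenbergAcFibrePinningAt_of_residualEqualityForall (W : WeierstrassCurve ℚ) [W.IsElliptic] [W.IsGloballyMinimal]
    (K : Type) [Field K] [NumberField K] (hres : GreenbergResidualEqualityForallAt W K) : GreenbergAcFibrePinningAt W K := by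
  intro _ ι v vbar κ₁ κ₂ γ₁ γ₂ _ _ f hf _ hv hvbar hne hι Ω δ Ωp LK G hΩ hδ hLK hG J hJ C₀ hC₀
  obtain ⟨hC', hGC⟩ := hres ι v vbar κ₁ κ₂ γ₁ γ₂ f hf hv hvbar hne hι Ω δ Ωp LK G hΩ hδ hLK hG J hJ C₀ hC₀
  refine ⟨⊥, Ideal.isPrime_bot, ?_, fun a C₁ haC₁ hC₁ => ?_⟩
  · intro hG0
    have hG0' : red₂ G = 0 := by simpa using hG0
    have hmem : red₂ (toUnr₂ 2 J C₀) ∈ Ideal.span {red₂ G} := hGC ▸ Ideal.mem_span_singleton_self _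
    rw [hG0', Ideal.span_singleton_eq_bot.mpr rfl, Ideal.mem_bot] at hmem
    exact hC' hmem
  · rw [bot_sup_eq, hGC]
    rcases Nat.eq_zero_or_pos a with rfl | ha
    · rw [pow_zero, one_mul] at haC₁
      rw [← haC₁]; exact Ideal.mem_span_singleton_self _
    · exfalso
      apply hC'
      have hred2 : red₂ (2 : A₂) = 0 := by
        have h := Summit.BirchSwinnertonDyer.BirchSwinnertonDyer.Theorems.TwoAdicBDPPrimePinning.map_map_residue_natCast_prime (p := 2)
        rw [Nat.cast_ofNat] at h
        exact h
      rw [haC₁, map_mul, map_pow, hred2, zero_pow ha.ne', zero_mul]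

/-- `Rres → ACPIN` on the habitat. -/
theorem acFibrePinningAtTwo_of_residualEqualityForallAtTwo :
    TwoVariableResidualEqualityForallAtTwo → AcFibrePinningAtTwo :=
  fun h W _ _ hCM hGO hβ K _ _ hK => greenbergAcFibrePinningAt_of_residualEqualityForall W K (h W hCM hGO hβ K hK)

/-- The v4.1 research set still closes O2 under the ACPIN node: `O2 ⟸ P0 ∧ PIN ∧ CONTENT ∧ U ∧ R0T ∧ Rres` via `Rres ⇒ ACPIN`. -/
theorem bdpSelmerLowerDivisibilityAtTwo_of_residual_via_acPin :
    XGr₂CharIdealPrincipalAtTwo → PrimePinning₂ → TwoContent₂ → TwoVariableUpperInclusionRatAtTwo →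
      TwoVariableFrameTorsionAtTwo → TwoVariableResidualEqualityForallAtTwo → O2Goal :=
  fun hP hPin hCt hU h0 hres => bdpSelmerLowerDivisibilityAtTwo_of_acPieces hP hPin hCt hU h0
    (acFibrePinningAtTwo_of_residualEqualityForallAtTwo hres)

/-! ## §6 (k2) ACPIN ⟸ a ONE-LINE reading through ANY surjective residual line functional (seat 2 g3/g4's seam; PROVED, unregistered)

Seat 2's `anticyclotomic_line_reading_two` (ACLR) reads (N) and (Λ) on the in-frame anticyclotomic `ℤ₂`-line through
`red₁ ∘ lineRes J a b : 𝒪_{ℂ₂}⟦T₁,T₂⟧ → 𝔽̄₂⟦T⟧`; seat 2 g4's `residual_selmer_control_two` re-types the Λ-half of that reading in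
`λ`-currency (`dvd_iff_order_le`: in `𝔽̄₂⟦T⟧`, for `g ≠ 0`, `g ∣ c ↔ ord_T g ≤ ord_T c`).  The sub-node below is the
COMPOSITION-LEVEL content of both, against THIS file's frame: for ANY surjective ring map `φ : 𝔽̄₂⟦T₁,T₂⟧ → 𝔽̄₂⟦T⟧` (its kernel
is then a prime — `𝔽̄₂⟦T⟧` is a domain), N_φ `φ(red G) ≠ 0` and λ_φ `ord_T φ(red G) ≤ ord_T φ(red C₁)` give `FibrePinned G C'`
with `𝔓 := ker φ`.  The INTENDED `φ` is the residual anticyclotomic line functional of the pair (seat 2's `lineRes J κ_ac(γ₁)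
κ_ac(γ₂)` reduced); naming it needs the anticyclotomic `ℤ₂`-extension as DATA relative to the pair — not typed here, so N_ac
and Λ_ac stay coupled by `∃ φ` (ACLR♮ below) and ACPIN remains the registered stub. -/

section LineReading

variable {k : Type*} [Field k]

/-- In `k⟦T⟧` (`k` a field) a non-zero `g` divides every `c` with `ord_T g ≤ ord_T c` (seat 2 g4's `dvd_of_order_le`,
re-proved here because Cruxes files are not importable modules). -/
theorem dvd_of_order_le' {g c : PowerSeries k} (hg : g ≠ 0) (h : g.order ≤ c.order) : g ∣ c := by
  by_cases hc0 : c = 0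
  · simp [hc0]
  have hcfin : c.order ≠ ⊤ := fun htop => hc0 (PowerSeries.order_eq_top.mp htop)
  have hle : g.order.toNat ≤ c.order.toNat := ENat.toNat_le_toNat h hcfin
  obtain ⟨u, hu⟩ := PowerSeries.isUnit_divided_by_X_pow_order hg
  have h1 : g ∣ (PowerSeries.X : PowerSeries k) ^ g.order.toNat := by
    refine ⟨↑u⁻¹, ?_⟩
    calc (PowerSeries.X : PowerSeries k) ^ g.order.toNat
        = PowerSeries.X ^ g.order.toNat * (g.divXPowOrder * ↑u⁻¹) := by
          rw [← hu, Units.mul_inv, mul_one]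
      _ = (PowerSeries.X ^ g.order.toNat * g.divXPowOrder) * ↑u⁻¹ := by ring
      _ = g * ↑u⁻¹ := by rw [PowerSeries.X_pow_order_mul_divXPowOrder]
  exact h1.trans ((pow_dvd_pow _ hle).trans PowerSeries.X_pow_order_dvd)

end LineReading

/-- **FibrePinned from a one-line reading** (kernel): `φ : 𝔽̄₂⟦T₁,T₂⟧ →+* 𝔽̄₂⟦T⟧` surjective, N_φ `φ (red₂ G) ≠ 0`, λ_φ
`ord (φ (red₂ G)) ≤ ord (φ (red₂ C₁))` for every primitive part `C₁` of `C'` ⟹ `FibrePinned G C'` (with `𝔓 = ker φ`). -/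
theorem fibrePinned_of_lineReading (G C' : A₂) (φ : Ω₂ →+* Ω₁) (hφ : Function.Surjective φ)
    (hN : φ (red₂ G) ≠ 0)
    (hΛ : ∀ (a : ℕ) (C₁ : A₂), C' = (2 : A₂) ^ a * C₁ → red₂ C₁ ≠ 0 → (φ (red₂ G)).order ≤ (φ (red₂ C₁)).order) :
    FibrePinned G C' := by
  refine ⟨RingHom.ker φ, RingHom.ker_isPrime φ, by rwa [RingHom.mem_ker], fun a C₁ haC₁ hC₁ => ?_⟩
  obtain ⟨q, hq⟩ := dvd_of_order_le' hN (hΛ a C₁ haC₁ hC₁)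
  obtain ⟨Q, rfl⟩ := hφ q
  have hker : red₂ C₁ - red₂ G * Q ∈ RingHom.ker φ := by
    rw [RingHom.mem_ker, map_sub, map_mul, hq, sub_self]
  have : red₂ C₁ = (red₂ C₁ - red₂ G * Q) + red₂ G * Q := by ring
  rw [this]
  exact Submodule.add_mem_sup hker (Ideal.mem_span_singleton'.mpr ⟨Q, by ring⟩)

/-- **ACLR♮ at `(E,K)`** — the one-line reading in `∃φ`-form: for every admissible frame datum, `J`, generator `C₀`, SOME surjective
residual line functional `φ` carries N_φ (`μ = 0` of `G` on that residual line) and λ_φ (`λ(G|_φ) ≤ λ(C₁|_φ)` for the primitive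
part of `J C₀`).  Intended `φ` = the in-frame anticyclotomic line; typed WEAKER (any line will do). -/
def GreenbergAcLineReadingAt (W : WeierstrassCurve ℚ) [W.IsElliptic] [W.IsGloballyMinimal]
    (K : Type) [Field K] [NumberField K] : Prop :=
  ∀ [IsCMField K] (ι : PadicAlgCl 2 ≃+* ℂ) (v vbar : HeightOneSpectrum (𝓞 K)) (κ₁ κ₂ : ZpExtension K 2)
    (γ₁ γ₂ : absoluteGaloisGroup K) [Fact (ZpExtension.IsTopGeneratorPair κ₁ κ₂ γ₁ γ₂)]
    [NeZero (W.conductorNorm ℤ)] (f : CuspForm (Gamma0 (W.conductorNorm ℤ)) 2),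
    ModularForms.IsNewformOf W f → ∀ [NeZero (NumberField.discr K).natAbs],
    ((2 : ℕ) : 𝓞 K) ∈ v.asIdeal → ((2 : ℕ) : 𝓞 K) ∈ vbar.asIdeal → vbar ≠ v →
    (∀ (w : InfinitePlace K) (k : 𝓞 K), k ∈ v.asIdeal ↔ ‖ι.symm (w.embedding (k : K))‖ < 1) →
    ∀ (Ω δ : ℂ) (Ωp : (unrIntegers 2)ˣ) (LK G : A₂),
      Ω ≠ 0 → (δ ^ 2 = (NumberField.discr K : ℂ) ∨ δ ^ 2 = -(NumberField.discr K : ℂ)) →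
      IsKatzMeasure₂ ι v vbar ∅ κ₁ κ₂ γ₁⁻¹ γ₂⁻¹ 1 Ω δ ((Ωp : unrIntegers 2) : ℂ_[2]) LK →
      IsGreenbergLFunctionFree₂ ι v vbar κ₁ κ₂ γ₁⁻¹ γ₂⁻¹ f (NumberField.discr K).natAbs
        (NumberField.classNumber K) LK G →
      ∀ J : ℤ_[2] →+* PadicComplexInt 2,
        (∀ x : ℤ_[2], ((J x : PadicComplexInt 2) : ℂ_[2]) = ((x : ℚ_[2]) : ℂ_[2])) →
        ∀ C₀ : IwasawaAlgebra₂ 2,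
          WeierstrassCurve.XGr₂.charIdeal (W.baseChange K) 2 κ₁ κ₂ vbar γ₁ γ₂ = Ideal.span {C₀} →
          ∃ φ : Ω₂ →+* Ω₁, Function.Surjective φ ∧ φ (red₂ G) ≠ 0 ∧
            ∀ (a : ℕ) (C₁ : A₂), toUnr₂ 2 J C₀ = (2 : A₂) ^ a * C₁ → red₂ C₁ ≠ 0 →
              (φ (red₂ G)).order ≤ (φ (red₂ C₁)).order

/-- ACLR♮ on the habitat (β) — N_ac ∧ λ_ac read through one residual line functional per datum.  Unregistered (card §v6). -/
def AcLineReadingAtTwo : Prop :=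
  ∀ (W : WeierstrassCurve ℚ) [W.IsElliptic] [W.IsGloballyMinimal],
    ¬ W.HasCM → GoodOrd W 2 → ¬ W.HasIrreducibleModPGaloisRep 2 →
    ∀ (K : Type) [Field K] [NumberField K],
      (IsImaginaryQuadratic K ∧ SatisfiesHeegnerHypothesis (2 * W.conductorNorm ℤ) K) →
      GreenbergAcLineReadingAt W K

/-- **(k2) sub-node: ACLR♮ ⇒ ACPIN at a datum** (`fibrePinned_of_lineReading`). -/
theorem greenbergAcFibrePinningAt_of_lineReading (W : WeierstrassCurve ℚ) [W.IsElliptic] [W.IsGloballyMinimal]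
    (K : Type) [Field K] [NumberField K] (h : GreenbergAcLineReadingAt W K) : GreenbergAcFibrePinningAt W K := by
  intro _ ι v vbar κ₁ κ₂ γ₁ γ₂ _ _ f hf _ hv hvbar hne hι Ω δ Ωp LK G hΩ hδ hLK hG J hJ C₀ hC₀
  obtain ⟨φ, hφ, hN, hΛ⟩ := h ι v vbar κ₁ κ₂ γ₁ γ₂ f hf hv hvbar hne hι Ω δ Ωp LK G hΩ hδ hLK hG J hJ C₀ hC₀
  exact fibrePinned_of_lineReading G (toUnr₂ 2 J C₀) φ hφ hN hΛ

/-- **(k2) sub-node on the habitat: `ACLR♮ → ACPIN`** (`acFibrePinning_of_nac_of_lambdaAc` in the pen's wording, with N_ac and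
λ_ac coupled by the line functional). -/
theorem acFibrePinningAtTwo_of_acLineReading : AcLineReadingAtTwo → AcFibrePinningAtTwo :=
  fun h W _ _ hCM hGO hβ K _ _ hK => greenbergAcFibrePinningAt_of_lineReading W K (h W hCM hGO hβ K hK)

/-- The node through the one-line reading: `O2 ⟸ PRINT{thmII417} ∧ U ∧ R0G ∧ (TORSION ∧ RESIDUE) ∧ ACLR♮`, sorry-free. -/
theorem bdpSelmerLowerDivisibilityAtTwo_of_katzSheet_of_torsionResidue_of_lineReading
    (hdS : DeShalit1987.thmII417_exists_katzSheet) :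
    TwoVariableUpperInclusionRatAtTwo → TwoVariableGreenbergObjectAtTwo → TwoVariableTorsionResidueAtTwo →
      AcLineReadingAtTwo → O2Goal :=
  fun hU hG hT hR => bdpSelmerLowerDivisibilityAtTwo_of_katzSheet_of_torsionResidue_of_acPin hdS hU hG hT
    (acFibrePinningAtTwo_of_acLineReading hR)

/-! ## §7 ACPIN-NEC (lead g15; audit-2 ADDENDUM-5 §A5.2, BY NAME from `Theorems/…AtTwoAcPinNecessary.lean`, p781951)

At a datum where the W⁺ READING holds — `G(0,0) = 4·unit` at (1289a1 | 1913b1, ℚ(√−7)), `G(0,0) ∈ 2⁴𝒪_{ℂ₂}` at (113a1, ℚ(√−7))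
(eng-2 RS-DIAGONAL v1 read by audit-2 ADDENDUM-5 @1049a3e3c6ced77e), in particular `G(0,0) ∈ 𝔪_{𝒪_{ℂ₂}}` — `red₂ G` lies in
`𝔫 = (T₁,T₂)`; any prime `𝔓` of the LOCAL ring `Ω₂` is proper, so `𝔓 ⊔ (red₂ G) ≤ 𝔫`, and clause (Λ) of `FibrePinned` puts
`red₂ C₁ ∈ 𝔫`, i.e. `C₁(0,0) ∈ 𝔪_{𝒪_{ℂ₂}}`, for EVERY primitive part `C₁`; along `toUnr₂ 2 J` this says `ch_{Λ_K}(X_Gr₂) ≠ (2^μ)`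
for every `μ` (the `μ`-free part of the characteristic power series is a NON-UNIT of `ℤ₂⟦T₁⟧⟦T₂⟧`; `X_Gr₂` is not
pseudo-pure-`μ`, not pseudo-null).  HONEST SCOPE: the hypothesis `hG0` below is the instrument READING (a fact about O2's `G`
IF O2 holds at the datum), the theorems are the IMPLICATION; nothing is decided about N_ac / Λ_ac; no stub changes; the stub
set stays {U, R0G, PRINT-OV16, ACPIN}.  USE: an algebraic-side necessary condition for ACPIN (2-descent / AC-CONTROL₂(β)
reachable) and a refutation handle (a proof of `ch(X_Gr₂) = (2^μ)` at a W⁺ datum kills ACPIN there). -/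

/-- **ACPIN-NEC, primitive-part form** on this file's objects (BY NAME, p781951
`TwoAdicBDPAcPinNecessary.constantCoeff_constantCoeff_mem_maximalIdeal_of_fibrePinned_two`): `FibrePinned G C'` and
`G(0,0) ∈ 𝔪_{𝒪_{ℂ₂}}` ⟹ every primitive part `C₁` of `C'` (`C' = 2^a·C₁`, `red₂ C₁ ≠ 0`) has `C₁(0,0) ∈ 𝔪_{𝒪_{ℂ₂}}`. -/
theorem constantCoeff_mem_maximalIdeal_of_fibrePinned (G C' : A₂) (hpin : FibrePinned G C')
    (hG0 : PowerSeries.constantCoeff (PowerSeries.constantCoeff G) ∈ IsLocalRing.maximalIdeal (PadicComplexInt 2))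
    (a : ℕ) (C₁ : A₂) (hC' : C' = (2 : A₂) ^ a * C₁) (hC₁ : red₂ C₁ ≠ 0) :
    PowerSeries.constantCoeff (PowerSeries.constantCoeff C₁) ∈ IsLocalRing.maximalIdeal (PadicComplexInt 2) :=
  Summit.BirchSwinnertonDyer.BirchSwinnertonDyer.Theorems.TwoAdicBDPAcPinNecessary.constantCoeff_constantCoeff_mem_maximalIdeal_of_fibrePinned_two
    G C' hpin hG0 a C₁ hC' hC₁

/-- **ACPIN-NEC, unit form**: under `FibrePinned G C'` and `G(0,0) ∈ 𝔪`, `C'` is never `2^a · u` with `u ∈ A₂ˣ`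
(BY NAME, `…AcPinNecessary.not_isUnit_of_fibrePinned_two`). -/
theorem not_isUnit_of_fibrePinned (G C' : A₂) (hpin : FibrePinned G C')
    (hG0 : PowerSeries.constantCoeff (PowerSeries.constantCoeff G) ∈ IsLocalRing.maximalIdeal (PadicComplexInt 2))
    (a : ℕ) (u : A₂) (hC' : C' = (2 : A₂) ^ a * u) : ¬ IsUnit u :=
  Summit.BirchSwinnertonDyer.BirchSwinnertonDyer.Theorems.TwoAdicBDPAcPinNecessary.not_isUnit_of_fibrePinned_two
    G C' hpin hG0 a u hC'

/-- **ACPIN-NEC on `Λ_K`**: `FibrePinned G (toUnr₂ 2 J C₀)` and `G(0,0) ∈ 𝔪` ⟹ `(C₀) ≠ (2^μ)` in `ℤ₂⟦T₁⟧⟦T₂⟧` for every `μ`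
(BY NAME, `…AcPinNecessary.span_singleton_ne_span_two_pow_of_fibrePinned`). -/
theorem span_ne_span_two_pow_of_fibrePinned (G : A₂) (J : ℤ_[2] →+* PadicComplexInt 2) (C₀ : IwasawaAlgebra₂ 2)
    (hpin : FibrePinned G (toUnr₂ 2 J C₀))
    (hG0 : PowerSeries.constantCoeff (PowerSeries.constantCoeff G) ∈ IsLocalRing.maximalIdeal (PadicComplexInt 2))
    (μ : ℕ) : Ideal.span {C₀} ≠ Ideal.span {(2 : IwasawaAlgebra₂ 2) ^ μ} :=
  Summit.BirchSwinnertonDyer.BirchSwinnertonDyer.Theorems.TwoAdicBDPAcPinNecessary.span_singleton_ne_span_two_pow_of_fibrePinned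
    J C₀ G hpin hG0 μ

/-- ★ **ACPIN-NEC at a datum `(E,K)`** — the instantiation at `GreenbergAcFibrePinningAt W K` (the registered stub ACPIN at a
datum): for every admissible frame datum `(ι, v, v̄, κ₁, κ₂, γ₁, γ₂, f, Ω, δ, Ω_p, L_K, G)` whose Greenberg function has
`G(0,0) ∈ 𝔪_{𝒪_{ℂ₂}}` (the W⁺ reading), every structure map `J` and every generator `C₀` of `ch_{Λ_K}(X_Gr₂(E_K/K̃_∞))`:
`ch_{Λ_K}(X_Gr₂) ≠ (2^μ)` for every `μ`.  Sorry-free; the implication only. -/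
theorem charIdeal_ne_span_two_pow_of_greenbergAcFibrePinningAt (W : WeierstrassCurve ℚ) [W.IsElliptic] [W.IsGloballyMinimal]
    (K : Type) [Field K] [NumberField K] (hpin : GreenbergAcFibrePinningAt W K)
    [IsCMField K] (ι : PadicAlgCl 2 ≃+* ℂ) (v vbar : HeightOneSpectrum (𝓞 K)) (κ₁ κ₂ : ZpExtension K 2)
    (γ₁ γ₂ : absoluteGaloisGroup K) [Fact (ZpExtension.IsTopGeneratorPair κ₁ κ₂ γ₁ γ₂)]
    [NeZero (W.conductorNorm ℤ)] (f : CuspForm (Gamma0 (W.conductorNorm ℤ)) 2) (hf : ModularForms.IsNewformOf W f)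
    [NeZero (NumberField.discr K).natAbs]
    (hv : ((2 : ℕ) : 𝓞 K) ∈ v.asIdeal) (hvbar : ((2 : ℕ) : 𝓞 K) ∈ vbar.asIdeal) (hne : vbar ≠ v)
    (hι : ∀ (w : InfinitePlace K) (k : 𝓞 K), k ∈ v.asIdeal ↔ ‖ι.symm (w.embedding (k : K))‖ < 1)
    (Ω δ : ℂ) (Ωp : (unrIntegers 2)ˣ) (LK G : A₂) (hΩ : Ω ≠ 0)
    (hδ : δ ^ 2 = (NumberField.discr K : ℂ) ∨ δ ^ 2 = -(NumberField.discr K : ℂ))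
    (hLK : IsKatzMeasure₂ ι v vbar ∅ κ₁ κ₂ γ₁⁻¹ γ₂⁻¹ 1 Ω δ ((Ωp : unrIntegers 2) : ℂ_[2]) LK)
    (hG : IsGreenbergLFunctionFree₂ ι v vbar κ₁ κ₂ γ₁⁻¹ γ₂⁻¹ f (NumberField.discr K).natAbs (NumberField.classNumber K) LK G)
    (hG0 : PowerSeries.constantCoeff (PowerSeries.constantCoeff G) ∈ IsLocalRing.maximalIdeal (PadicComplexInt 2))
    (J : ℤ_[2] →+* PadicComplexInt 2) (hJ : ∀ x : ℤ_[2], ((J x : PadicComplexInt 2) : ℂ_[2]) = ((x : ℚ_[2]) : ℂ_[2]))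
    (C₀ : IwasawaAlgebra₂ 2)
    (hC₀ : WeierstrassCurve.XGr₂.charIdeal (W.baseChange K) 2 κ₁ κ₂ vbar γ₁ γ₂ = Ideal.span {C₀}) (μ : ℕ) :
    WeierstrassCurve.XGr₂.charIdeal (W.baseChange K) 2 κ₁ κ₂ vbar γ₁ γ₂ ≠ Ideal.span {(2 : IwasawaAlgebra₂ 2) ^ μ} := by
  rw [hC₀]
  exact span_ne_span_two_pow_of_fibrePinned G J C₀
    (hpin ι v vbar κ₁ κ₂ γ₁ γ₂ f hf hv hvbar hne hι Ω δ Ωp LK G hΩ hδ hLK hG J hJ C₀ hC₀) hG0 μ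

/-- **ACPIN-NEC on the habitat (β)**: the registered stub ACPIN (`AcFibrePinningAtTwo`) implies, at every habitat datum whose
Greenberg function reads `G(0,0) ∈ 𝔪`, `ch_{Λ_K}(X_Gr₂) ≠ (2^μ)` for every `μ`.  (A consequence OF the stub, displayed for
the census; it neither proves nor refutes the stub.) -/
theorem charIdeal_ne_span_two_pow_of_acFibrePinningAtTwo (hpin : AcFibrePinningAtTwo)
    (W : WeierstrassCurve ℚ) [W.IsElliptic] [W.IsGloballyMinimal]
    (hCM : ¬ W.HasCM) (hGO : GoodOrd W 2) (hβ : ¬ W.HasIrreducibleModPGaloisRep 2)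
    (K : Type) [Field K] [NumberField K]
    (hK : IsImaginaryQuadratic K ∧ SatisfiesHeegnerHypothesis (2 * W.conductorNorm ℤ) K)
    [IsCMField K] (ι : PadicAlgCl 2 ≃+* ℂ) (v vbar : HeightOneSpectrum (𝓞 K)) (κ₁ κ₂ : ZpExtension K 2)
    (γ₁ γ₂ : absoluteGaloisGroup K) [Fact (ZpExtension.IsTopGeneratorPair κ₁ κ₂ γ₁ γ₂)]
    [NeZero (W.conductorNorm ℤ)] (f : CuspForm (Gamma0 (W.conductorNorm ℤ)) 2) (hf : ModularForms.IsNewformOf W f)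
    [NeZero (NumberField.discr K).natAbs]
    (hv : ((2 : ℕ) : 𝓞 K) ∈ v.asIdeal) (hvbar : ((2 : ℕ) : 𝓞 K) ∈ vbar.asIdeal) (hne : vbar ≠ v)
    (hι : ∀ (w : InfinitePlace K) (k : 𝓞 K), k ∈ v.asIdeal ↔ ‖ι.symm (w.embedding (k : K))‖ < 1)
    (Ω δ : ℂ) (Ωp : (unrIntegers 2)ˣ) (LK G : A₂) (hΩ : Ω ≠ 0)
    (hδ : δ ^ 2 = (NumberField.discr K : ℂ) ∨ δ ^ 2 = -(NumberField.discr K : ℂ))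
    (hLK : IsKatzMeasure₂ ι v vbar ∅ κ₁ κ₂ γ₁⁻¹ γ₂⁻¹ 1 Ω δ ((Ωp : unrIntegers 2) : ℂ_[2]) LK)
    (hG : IsGreenbergLFunctionFree₂ ι v vbar κ₁ κ₂ γ₁⁻¹ γ₂⁻¹ f (NumberField.discr K).natAbs (NumberField.classNumber K) LK G)
    (hG0 : PowerSeries.constantCoeff (PowerSeries.constantCoeff G) ∈ IsLocalRing.maximalIdeal (PadicComplexInt 2))
    (J : ℤ_[2] →+* PadicComplexInt 2) (hJ : ∀ x : ℤ_[2], ((J x : PadicComplexInt 2) : ℂ_[2]) = ((x : ℚ_[2]) : ℂ_[2]))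
    (C₀ : IwasawaAlgebra₂ 2)
    (hC₀ : WeierstrassCurve.XGr₂.charIdeal (W.baseChange K) 2 κ₁ κ₂ vbar γ₁ γ₂ = Ideal.span {C₀}) (μ : ℕ) :
    WeierstrassCurve.XGr₂.charIdeal (W.baseChange K) 2 κ₁ κ₂ vbar γ₁ γ₂ ≠ Ideal.span {(2 : IwasawaAlgebra₂ 2) ^ μ} :=
  charIdeal_ne_span_two_pow_of_greenbergAcFibrePinningAt W K (hpin W hCM hGO hβ K hK) ι v vbar κ₁ κ₂ γ₁ γ₂ f hf hv hvbar
    hne hι Ω δ Ωp LK G hΩ hδ hLK hG hG0 J hJ C₀ hC₀ μ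

/-! ## §8 THE PRICE OF ACPIN AT EVERY (β) DATUM (lead g16; event (e15) «THE DOOR BY NAME», tower-1 GEN 52–55, BY NAME from
`Theorems/TwoAdicConverseBDPAcLineCoinvariantDatumGoodOrd.lean`, p793449)

The door `X_Gr₂ → 𝔛_ac` along the anticyclotomic line of the pair, in the pair's coordinates, is in the tree (GEN 53 AC-LINE SPEC₂
p783462/p783595/p783980, GEN 54 COINVARIANT DOOR p788466/p788820/p788908, GEN 55 PRINT-LEVEL RESIDUALS p792614/p793101/p793449):
at a (β) rank-one frame datum — `W/ℚ` globally minimal with `GoodOrd W 2`, `K` imaginary quadratic with `2` split `v ≠ v̄`, `κ₂`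
anticyclotomic with top generator `γ₂`, `rank E(K) = 1`, `#Ш(E/K)[2^∞] < ∞`, `ch_{Λ_K}(X_Gr₂) = (C₀)`, a primitive part `C₁` of
`toUnr₂ 2 J C₀ = 2^a·C₁` — the binder `hpin : FibrePinned G (toUnr₂ 2 J C₀)` together with the W⁺ reading `G(0,0) ∈ 𝔪_{𝒪_{ℂ₂}}`
FORCES the budget inequality **`1 + a ≤ k + m`** (`m` = `HasCharValuationAt … m` = `ord₂ 𝓕_ac(0)` of LINK A₂ p782024/p782166, `k` = the
control exponent of the door, `a` = the two-variable `2`-content of `ch X_Gr₂`), modulo PRINT{F4a, F4b} ONLY (Greenberg LNM 1716 §2: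
`ordinaryReduction_inertia_smul_of_mem_kernelReduction`, `ordinaryReduction_exists_unramified_character_mod_kernelReduction`; `hgen` is the
THEOREM `acLineFrobeniusGeneratesAtTwo`, p792614; tower-1 GEN 56 «F4 DISCHARGE» is keyed, not landed at this gen).  Below: the registered stub
ACPIN, specialised to the frame's `J`, `C₀`, IS that `hpin` binder, so ACPIN COSTS `1 + a ≤ k + m` at every (β) datum.  HONEST SCOPE: this is
a NECESSARY condition in the kernel — an upper-bound / control-side statement that can EXCLUDE pinning at a datum (a datum with `k + m ≤ a`
refutes ACPIN there) but can never SUPPLY it; ACPIN's (Λ)-side lower bound stays RESEARCH; no stub, no node, no signature changes; the stub set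
stays {U, R0G, PRINT-OV16, ACPIN}; nothing is decided about any curve (audit-2 ADDENDUM-6 @f240944fdca38ba2: `m`, `a`, `k` are algebraic and
UNREAD by every instrument; «1 + a ≤ k + m» consistent-in-shadow ×6, excluded ×0). -/

/-- ★ **WHAT `stub_acFibrePinning` COSTS AT EVERY (β) DATUM — `1 + a ≤ k + m`, modulo PRINT{F4a, F4b} only** (BY NAME,
`TwoAdicBDPAcLineSpec.one_add_le_of_fibrePinned_of_rankOne_of_print_of_goodOrd`, p793449).  Hypotheses: the two print facts F4a/F4b
(Greenberg LNM 1716 §2, typed p792990); the registered stub ACPIN (`AcFibrePinningAtTwo`); a habitat datum `(W, K)` of (β) (`¬CM`,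
`GoodOrd W 2`, `E[2]` reducible, `K` imaginary quadratic with the Heegner hypothesis for `2N` — whence `2` splits in `K`, derived, not
assumed); an admissible frame datum `(ι, v, v̄, κ₁, κ₂, γ₁, γ₂, f, Ω, δ, Ω_p, L_K, G)` with `κ₂` anticyclotomic, `γ₂` a top generator of
`κ₂`, and the W⁺ reading `G(0,0) ∈ 𝔪_{𝒪_{ℂ₂}}`; a structure map `J`, a generator `C₀` of `ch_{Λ_K}(X_Gr₂(E_K/K̃_∞))` and a primitive part
`C₁` (`toUnr₂ 2 J C₀ = 2^a·C₁`, `red₂ C₁ ≠ 0`); `rank E(K) = 1` and `#Ш(E/K)[2^∞] < ∞`.  Conclusion: there are `m k : ℕ` and a unit `u` of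
`𝒪_{ℂ₂}` with `HasCharValuationAt E_K 2 κ₂ v̄ ∅ γ₂ m` (LINK A₂'s `m`), `(J C₀)(0,0) ∣ 2^{k+m}·u`, and **`1 + a ≤ k + m`**.  A consequence OF
the stub displayed for the census (FibrePinned ⟹ PINNING NEEDS BUDGET); it neither proves nor refutes ACPIN; CM is excluded only because
the habitat excludes it.  [folklore] [cite: GreenbergLNM1716, §2 pp. 70–71, 76] -/
theorem acFibrePinning_needs_budget_at_beta
    (hF4a : ordinaryReduction_inertia_smul_of_mem_kernelReduction)
    (hF4b : ordinaryReduction_exists_unramified_character_mod_kernelReduction)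
    (hpin : AcFibrePinningAtTwo)
    (W : WeierstrassCurve ℚ) [W.IsElliptic] [W.IsGloballyMinimal]
    (hCM : ¬ W.HasCM) (hGO : GoodOrd W 2) (hβ : ¬ W.HasIrreducibleModPGaloisRep 2)
    (K : Type) [Field K] [NumberField K]
    (hK : IsImaginaryQuadratic K ∧ SatisfiesHeegnerHypothesis (2 * W.conductorNorm ℤ) K)
    [IsCMField K] (ι : PadicAlgCl 2 ≃+* ℂ) (v vbar : HeightOneSpectrum (𝓞 K)) (κ₁ κ₂ : ZpExtension K 2)
    (γ₁ γ₂ : absoluteGaloisGroup K) [Fact (ZpExtension.IsTopGeneratorPair κ₁ κ₂ γ₁ γ₂)] [Fact (κ₂.IsTopGenerator γ₂)]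
    (hκ₂ : κ₂.IsAnticyclotomic)
    [NeZero (W.conductorNorm ℤ)] (f : CuspForm (Gamma0 (W.conductorNorm ℤ)) 2) (hf : ModularForms.IsNewformOf W f)
    [NeZero (NumberField.discr K).natAbs]
    (hv : ((2 : ℕ) : 𝓞 K) ∈ v.asIdeal) (hvbar : ((2 : ℕ) : 𝓞 K) ∈ vbar.asIdeal) (hne : vbar ≠ v)
    (hι : ∀ (w : InfinitePlace K) (k : 𝓞 K), k ∈ v.asIdeal ↔ ‖ι.symm (w.embedding (k : K))‖ < 1)
    (Ω δ : ℂ) (Ωp : (unrIntegers 2)ˣ) (LK G : A₂) (hΩ : Ω ≠ 0)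
    (hδ : δ ^ 2 = (NumberField.discr K : ℂ) ∨ δ ^ 2 = -(NumberField.discr K : ℂ))
    (hLK : IsKatzMeasure₂ ι v vbar ∅ κ₁ κ₂ γ₁⁻¹ γ₂⁻¹ 1 Ω δ ((Ωp : unrIntegers 2) : ℂ_[2]) LK)
    (hG : IsGreenbergLFunctionFree₂ ι v vbar κ₁ κ₂ γ₁⁻¹ γ₂⁻¹ f (NumberField.discr K).natAbs (NumberField.classNumber K) LK G)
    (hG0 : PowerSeries.constantCoeff (PowerSeries.constantCoeff G) ∈ IsLocalRing.maximalIdeal (PadicComplexInt 2))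
    (J : ℤ_[2] →+* PadicComplexInt 2) (hJ : ∀ x : ℤ_[2], ((J x : PadicComplexInt 2) : ℂ_[2]) = ((x : ℚ_[2]) : ℂ_[2]))
    (C₀ : IwasawaAlgebra₂ 2)
    (hC₀ : WeierstrassCurve.XGr₂.charIdeal (W.baseChange K) 2 κ₁ κ₂ vbar γ₁ γ₂ = Ideal.span {C₀})
    (a : ℕ) (C₁ : A₂) (hC : toUnr₂ 2 J C₀ = (2 : A₂) ^ a * C₁) (hC₁ : red₂ C₁ ≠ 0)
    (hrank : (W.baseChange K).mordellWeilRank = 1)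
    (hsha : Finite (AddCommGroup.primaryComponent (W.baseChange K).sha 2)) :
    ∃ (m k : ℕ) (u : PadicComplexInt 2), AcSelmer.XAc.HasCharValuationAt (W.baseChange K) 2 κ₂ vbar ∅ γ₂ m ∧
      IsUnit u ∧ PowerSeries.constantCoeff (PowerSeries.constantCoeff (toUnr₂ 2 J C₀)) ∣
        (2 : PadicComplexInt 2) ^ (k + m) * u ∧ 1 + a ≤ k + m :=
  Summit.BirchSwinnertonDyer.BirchSwinnertonDyer.Theorems.TwoAdicBDPAcLineSpec.one_add_le_of_fibrePinned_of_rankOne_of_print_of_goodOrd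
    W κ₁ κ₂ vbar γ₁ γ₂ J C₀ G
    (hpin W hCM hGO hβ K hK ι v vbar κ₁ κ₂ γ₁ γ₂ f hf hv hvbar hne hι Ω δ Ωp LK G hΩ hδ hLK hG J hJ C₀ hC₀)
    hG0 a C₁ hC hC₁ hF4a hF4b hGO hK.1 (hK.2 2 Nat.prime_two (dvd_mul_right 2 _)) hκ₂ hv hvbar hne hrank hsha hC₀

end Summit.BirchSwinnertonDyer.BirchSwinnertonDyer.Cruxes.BDPSelmerLowerDivisibilityAtTwo.TwoVariableGvSqueezeTwo

end
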